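import Literature.Geometry.Lorentzian.CoordRicciEvolution
import HarnessLib

/-!
# Two metrics on one chart: difference identities and bounds (Kotschwar 2014, §1.1, static part)

Static layer of the energy argument for the uniqueness of the Ricci flow (Kotschwar 2014, §1.1:
"we organize the evolution equations satisfied by `h = g − g̃`, `A = ∇ − ∇̃`, `S = R − R̃` in such
a way that every term contains either a factor of one of the group or `∇S`", with the
identities `g⁻¹ − g̃⁻¹ = g̃⁻¹ ∗ h`, `(∇ − ∇̃)W = A ∗ W` ((5), (7))). Two fields of metric
components `G, G'` on the same open set `V ⊆ E` (`IsMetricOn`, the coordinate tensor calculus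
`CoordCurvature` … `CoordRicciEvolution`); we write `H = G − G'`, `A = Γ − Γ'` (Christoffel
maps), `P = Ric − Ric'`, `dP = DRic − DRic'`, `DA = DΓ − DΓ'` at a point `x`, and prove the
exact algebraic identities expressing the differences of the derived quantities through
`H, A, P, dP` (and, for second-order quantities, `DA`):

* `sharpAt_sub` — `♯ − ♯' = −♯ ∘ H ∘ ♯'` (Kotschwar (5): `g^{ij} − g̃^{ij} = −g^{ik} g̃^{jl} h_{kl}`),
  `ginv_sub`;
* `cov₂At_ricAt_sub` — `(∇Ric − ∇'Ric')(W;Y,Z) = dP(W;Y,Z) − Ric(A(W,Y),Z) − P(Γ'(W,Y),Z)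
  − Ric(Y,A(W,Z)) − P(Y,Γ'(W,Z))` (Kotschwar (7): `∇̃R̃c − ∇R̃c = A ∗ R̃c`);
* `riemAt_sub` — `R − R' = (DA(X)(Y) − DA(Y)(X)) + A_XΓ_Y + Γ'_XA_Y − A_YΓ_X − Γ'_YA_X`;
* `piFlowAt G x (X,Y) = −♯[(∇Ric)(X;Y,·) + (∇Ric)(Y;X,·) − (∇Ric)(·;X,Y)]` — the static form of
  the variation `Π = ∂_tΓ` under the Ricci flow (Kotschwar (6); `eq_piFlowAt_of_forall` identifies
  it from Topping's Prop. 2.3.1), and the bound `norm_piFlowAt_sub_apply_le` on `Π − Π' = ∂_t A`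
  (Kotschwar (9));
* `cov₃At_cov₂At_sub` — the difference of the second covariant derivative operators of the two
  metrics on a fixed smooth field `β`: `−β(DA(W)(X,Y),Z) − β(Y,DA(W)(X,Z))` plus a remainder
  `cov₃cov₂Rem` which is a sum of terms each containing one factor `A`;
* `ricEvolAt b G x Y Z = ΔRic(Y,Z) + (reaction)` — the right-hand side of the evolution of the
  Ricci tensor (`CoordRicciEvolution.hasDerivWithinAt_ricAt_ricciFlow`, Hamilton 1982, Cor. 7.3)
  and **`IsMetricOn.ricEvolAt_sub`**: `Λ(G) − Λ(G') = Σ g^{ij} D²P(bᵢ,bⱼ;·,·) + divRaw + fRaw`,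
  where `divRaw` collects the terms linear in `DA` (Kotschwar's `div U`, (8)) and `fRaw` the rest;
* the pointwise **bounds**: given a common bound `N` on the operator norms of the background
  quantities at `x` (`PairBound`), `‖Π − Π'‖ ≤ 27 N⁵ D` and `|fRaw| ≤ 76 n² N⁹ D ‖Y‖‖Z‖` with
  `D = ‖H‖ + ‖A‖ + ‖P‖ + ‖dP‖` (Kotschwar (9)–(10), compact case).

Everything is proved; no definition of `Prop` type other than the bookkeeping structure
`PairBound` (a conjunction of norm bounds at a point, not a named fact) is introduced. The
divergence form of `divRaw` and the energy argument follow in later files.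

## References

* B. Kotschwar, *An energy approach to the problem of uniqueness for the Ricci flow*,
  Comm. Anal. Geom. 22 (2014) 149–176 (arXiv:1206.3225), §1.1, (5)–(10). [Kotschwar2014]
* B. O'Neill, *Semi-Riemannian geometry with applications to relativity*, 1983, Ch. 3.
  [ONeill1983]
-/

noncomputable section

set_option maxSynthPendingDepth 3

open Set Filter ContinuousLinearMap Module
open scoped Topology ContDiff

namespace Literature.Geometry.Lorentzian

namespace MetricCoord

variable {E : Type*} [NormedAddCommGroup E] [NormedSpace ℝ E]

/-! ### Operator-norm helpers -/

section NormHelpers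

variable {F : Type*} [NormedAddCommGroup F] [NormedSpace ℝ F]

/-- `‖T a b c‖ ≤ ‖T‖ ‖a‖ ‖b‖ ‖c‖` for a trilinear map. [folklore] -/
theorem norm_map₃_le (T : E →L[ℝ] E →L[ℝ] E →L[ℝ] F) (a b c : E) :
    ‖T a b c‖ ≤ ‖T‖ * ‖a‖ * ‖b‖ * ‖c‖ :=
  calc ‖T a b c‖ ≤ ‖T a‖ * ‖b‖ * ‖c‖ := (T a).le_opNorm₂ b c
    _ ≤ ‖T‖ * ‖a‖ * ‖b‖ * ‖c‖ := by gcongr; exact T.le_opNorm a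

/-- `‖T a b c d‖ ≤ ‖T‖ ‖a‖ ‖b‖ ‖c‖ ‖d‖` for a `4`-linear map. [folklore] -/
theorem norm_map₄_le (T : E →L[ℝ] E →L[ℝ] E →L[ℝ] E →L[ℝ] F) (a b c d : E) :
    ‖T a b c d‖ ≤ ‖T‖ * ‖a‖ * ‖b‖ * ‖c‖ * ‖d‖ :=
  calc ‖T a b c d‖ ≤ ‖T a‖ * ‖b‖ * ‖c‖ * ‖d‖ := norm_map₃_le (T a) b c d
    _ ≤ ‖T‖ * ‖a‖ * ‖b‖ * ‖c‖ * ‖d‖ := by gcongr; exact T.le_opNorm a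

end NormHelpers

/-! ### First-order differences: `♯`, `g^{ij}`, `∇Ric` -/

section FirstOrder

variable {G G' : E → E →L[ℝ] E →L[ℝ] ℝ} {V : Set E} {x : E}

/-- **`♯ − ♯' = −♯ ∘ (G − G') ∘ ♯'`** (Kotschwar 2014, (5): `g^{ij} − g̃^{ij} = −g^{ik} g̃^{jl} h_{kl}`;
the resolvent identity `A⁻¹ − B⁻¹ = A⁻¹ (B − A) B⁻¹`). [cite: Kotschwar2014, §1.1 (5)] -/
theorem sharpAt_sub (hi : (G x).IsInvertible) (hi' : (G' x).IsInvertible) :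
    sharpAt G x - sharpAt G' x = -((sharpAt G x).comp ((G x - G' x).comp (sharpAt G' x))) := by
  have h1 : (G' x).comp (sharpAt G' x) = ContinuousLinearMap.id ℝ _ := hi'.self_comp_inverse
  have h2 : (sharpAt G x).comp (G x) = ContinuousLinearMap.id ℝ _ := hi.inverse_comp_self
  rw [ContinuousLinearMap.sub_comp, ContinuousLinearMap.comp_sub, ← ContinuousLinearMap.comp_assoc,
    h2, h1, ContinuousLinearMap.id_comp, ContinuousLinearMap.comp_id, neg_sub]

/-- `‖♯ − ♯'‖ ≤ ‖♯‖ ‖G − G'‖ ‖♯'‖`. [cite: Kotschwar2014, §1.1 (5)] -/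
theorem norm_sharpAt_sub_le (hi : (G x).IsInvertible) (hi' : (G' x).IsInvertible) :
    ‖sharpAt G x - sharpAt G' x‖ ≤ ‖sharpAt G x‖ * ‖G x - G' x‖ * ‖sharpAt G' x‖ := by
  rw [sharpAt_sub hi hi', norm_neg]
  calc ‖(sharpAt G x).comp ((G x - G' x).comp (sharpAt G' x))‖
      ≤ ‖sharpAt G x‖ * ‖(G x - G' x).comp (sharpAt G' x)‖ := opNorm_comp_le _ _
    _ ≤ ‖sharpAt G x‖ * (‖G x - G' x‖ * ‖sharpAt G' x‖) := by
        gcongr; exact opNorm_comp_le _ _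
    _ = ‖sharpAt G x‖ * ‖G x - G' x‖ * ‖sharpAt G' x‖ := by ring

variable {ι : Type*} [FiniteDimensional ℝ E] (b : Basis ι ℝ E)

/-- `g^{ij} − g'^{ij} = bⁱ((♯ − ♯') bʲ)`. [cite: Kotschwar2014, §1.1 (5)] -/
theorem ginv_sub (i j : ι) :
    ginv G b x i j - ginv G' b x i j = coordCLM b i ((sharpAt G x - sharpAt G' x) (coordCLM b j)) := by
  simp only [ginv, _root_.sub_apply, map_sub, coordCLM_apply]

/-- `|g^{ij} − g'^{ij}| ≤ ‖bⁱ‖ ‖♯‖ ‖G − G'‖ ‖♯'‖ ‖bʲ‖`. [cite: Kotschwar2014, §1.1 (5)] -/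
theorem abs_ginv_sub_le (hi : (G x).IsInvertible) (hi' : (G' x).IsInvertible) (i j : ι) :
    |ginv G b x i j - ginv G' b x i j| ≤
      ‖coordCLM b i‖ * (‖sharpAt G x‖ * ‖G x - G' x‖ * ‖sharpAt G' x‖) * ‖coordCLM b j‖ := by
  rw [ginv_sub b i j, ← Real.norm_eq_abs]
  calc ‖coordCLM b i ((sharpAt G x - sharpAt G' x) (coordCLM b j))‖
      ≤ ‖coordCLM b i‖ * ‖(sharpAt G x - sharpAt G' x) (coordCLM b j)‖ := le_opNorm _ _
    _ ≤ ‖coordCLM b i‖ * (‖sharpAt G x - sharpAt G' x‖ * ‖coordCLM b j‖) := by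
        gcongr; exact le_opNorm _ _
    _ ≤ ‖coordCLM b i‖ * ((‖sharpAt G x‖ * ‖G x - G' x‖ * ‖sharpAt G' x‖) * ‖coordCLM b j‖) := by
        gcongr; exact norm_sharpAt_sub_le hi hi'
    _ = _ := by ring

/-- **`(∇Ric − ∇'Ric')(W;Y,Z) = dP(W;Y,Z) − Ric(A(W,Y),Z) − P(Γ'(W,Y),Z) − Ric(Y,A(W,Z)) − P(Y,Γ'(W,Z))`**
with `A = Γ − Γ'`, `P = Ric − Ric'`, `dP = DRic − DRic'` (Kotschwar 2014, (7):
`∇̃_i R̃_{jk} − ∇_i R̃_{jk} = A^p_{ij} R̃_{pk} + A^p_{ik} R̃_{jp}`). [cite: Kotschwar2014, §1.1 (7)] -/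
theorem cov₂At_ricAt_sub (W Y Z : E) :
    cov₂At G (ricAt G) x W Y Z - cov₂At G' (ricAt G') x W Y Z =
      (fderiv ℝ (ricAt G) x - fderiv ℝ (ricAt G') x) W Y Z
        - ricAt G x ((chrAt G x - chrAt G' x) W Y) Z
        - (ricAt G x - ricAt G' x) (chrAt G' x W Y) Z
        - ricAt G x Y ((chrAt G x - chrAt G' x) W Z)
        - (ricAt G x - ricAt G' x) Y (chrAt G' x W Z) := by
  simp only [cov₂At_apply, _root_.sub_apply, map_sub]
  ring

/-- The bound `|(∇Ric − ∇'Ric')(W;Y,Z)| ≤ (‖dP‖ + 2‖Ric‖‖A‖ + 2‖Γ'‖‖P‖) ‖W‖‖Y‖‖Z‖`.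
[cite: Kotschwar2014, §1.1 (9)] -/
theorem abs_cov₂At_ricAt_sub_le (W Y Z : E) :
    |cov₂At G (ricAt G) x W Y Z - cov₂At G' (ricAt G') x W Y Z| ≤
      (‖fderiv ℝ (ricAt G) x - fderiv ℝ (ricAt G') x‖
        + 2 * ‖ricAt G x‖ * ‖chrAt G x - chrAt G' x‖
        + 2 * ‖chrAt G' x‖ * ‖ricAt G x - ricAt G' x‖) * ‖W‖ * ‖Y‖ * ‖Z‖ := by
  rw [cov₂At_ricAt_sub, ← Real.norm_eq_abs]
  set dP := fderiv ℝ (ricAt G) x - fderiv ℝ (ricAt G') x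
  set A := chrAt G x - chrAt G' x
  set P := ricAt G x - ricAt G' x
  have h1 : ‖dP W Y Z‖ ≤ ‖dP‖ * ‖W‖ * ‖Y‖ * ‖Z‖ := norm_map₃_le dP W Y Z
  have h2 : ‖ricAt G x (A W Y) Z‖ ≤ ‖ricAt G x‖ * ‖A‖ * ‖W‖ * ‖Y‖ * ‖Z‖ :=
    calc ‖ricAt G x (A W Y) Z‖ ≤ ‖ricAt G x‖ * ‖A W Y‖ * ‖Z‖ := le_opNorm₂ _ _ _
      _ ≤ ‖ricAt G x‖ * (‖A‖ * ‖W‖ * ‖Y‖) * ‖Z‖ := by gcongr; exact le_opNorm₂ _ _ _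
      _ = _ := by ring
  have h3 : ‖P (chrAt G' x W Y) Z‖ ≤ ‖chrAt G' x‖ * ‖P‖ * ‖W‖ * ‖Y‖ * ‖Z‖ :=
    calc ‖P (chrAt G' x W Y) Z‖ ≤ ‖P‖ * ‖chrAt G' x W Y‖ * ‖Z‖ := le_opNorm₂ _ _ _
      _ ≤ ‖P‖ * (‖chrAt G' x‖ * ‖W‖ * ‖Y‖) * ‖Z‖ := by gcongr; exact le_opNorm₂ _ _ _
      _ = _ := by ring
  have h4 : ‖ricAt G x Y (A W Z)‖ ≤ ‖ricAt G x‖ * ‖A‖ * ‖W‖ * ‖Y‖ * ‖Z‖ :=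
    calc ‖ricAt G x Y (A W Z)‖ ≤ ‖ricAt G x‖ * ‖Y‖ * ‖A W Z‖ := le_opNorm₂ _ _ _
      _ ≤ ‖ricAt G x‖ * ‖Y‖ * (‖A‖ * ‖W‖ * ‖Z‖) := by gcongr; exact le_opNorm₂ _ _ _
      _ = _ := by ring
  have h5 : ‖P Y (chrAt G' x W Z)‖ ≤ ‖chrAt G' x‖ * ‖P‖ * ‖W‖ * ‖Y‖ * ‖Z‖ :=
    calc ‖P Y (chrAt G' x W Z)‖ ≤ ‖P‖ * ‖Y‖ * ‖chrAt G' x W Z‖ := le_opNorm₂ _ _ _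
      _ ≤ ‖P‖ * ‖Y‖ * (‖chrAt G' x‖ * ‖W‖ * ‖Z‖) := by gcongr; exact le_opNorm₂ _ _ _
      _ = _ := by ring
  calc ‖dP W Y Z - ricAt G x (A W Y) Z - P (chrAt G' x W Y) Z - ricAt G x Y (A W Z)
        - P Y (chrAt G' x W Z)‖
      ≤ ‖dP W Y Z‖ + ‖ricAt G x (A W Y) Z‖ + ‖P (chrAt G' x W Y) Z‖ + ‖ricAt G x Y (A W Z)‖
        + ‖P Y (chrAt G' x W Z)‖ := by
        refine (norm_sub_le _ _).trans ?_
        gcongr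
        refine (norm_sub_le _ _).trans ?_
        gcongr
        refine (norm_sub_le _ _).trans ?_
        gcongr
        exact norm_sub_le _ _
    _ ≤ _ := by nlinarith [h1, h2, h3, h4, h5, norm_nonneg W, norm_nonneg Y, norm_nonneg Z]

end FirstOrder

/-! ### The variation of the Christoffel map under the flow and its difference -/

section PiFlow

variable [FiniteDimensional ℝ E] (G : E → E →L[ℝ] E →L[ℝ] ℝ)

/-- The covector combination `κ(X,Y) = (∇Ric)(X;Y,·) + (∇Ric)(Y;X,·) − (∇Ric)(·;X,Y)`, as a
trilinear map; under the Ricci flow `G(Π(X,Y), Z) = −κ(X,Y,Z)` (Topping 2006, Prop. 2.3.1 with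
`h = −2Ric`). [cite: Topping2006, Prop. 2.3.1] -/
def kappaAt (x : E) : E →L[ℝ] E →L[ℝ] E →L[ℝ] ℝ :=
  cov₂At G (ricAt G) x + swap₁₂ (cov₂At G (ricAt G) x) - swap₂₃ (swap₁₂ (cov₂At G (ricAt G) x))

/-- Unfolding lemma for `kappaAt`. [cite: Topping2006, Prop. 2.3.1] -/
@[simp]
theorem kappaAt_apply (x X Y Z : E) :
    kappaAt G x X Y Z = cov₂At G (ricAt G) x X Y Z + cov₂At G (ricAt G) x Y X Z
      - cov₂At G (ricAt G) x Z X Y := by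
  simp only [kappaAt, _root_.add_apply, _root_.sub_apply, swap₁₂_apply, swap₂₃_apply]

/-- **The variation `Π = ∂_tΓ` of the Christoffel map under the Ricci flow as a static
expression**: `piFlowAt G x (X, Y) = −♯ κ(X,Y)`, i.e.
`Π^k_{ij} = −g^{km}(∇_i R_{jm} + ∇_j R_{im} − ∇_m R_{ij})` (Kotschwar 2014, (6); Topping 2006,
Prop. 2.3.1 with `h = −2Ric`). [cite: Kotschwar2014, §1.1 (6)] -/
def piFlowAt (x : E) : E →L[ℝ] E →L[ℝ] E :=
  -((ContinuousLinearMap.compL ℝ E (E →L[ℝ] ℝ) E (sharpAt G x)).comp (kappaAt G x))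

/-- Unfolding lemma: `piFlowAt G x X Y = −♯(κ(X,Y))`. [cite: Kotschwar2014, §1.1 (6)] -/
@[simp]
theorem piFlowAt_apply (x X Y : E) : piFlowAt G x X Y = -sharpAt G x (kappaAt G x X Y) := by
  simp [piFlowAt]

variable {G} {x : E}

/-- **Identification of `Π`**: a bilinear map `Π` with `G(Π(X,Y), Z) = −κ(X,Y,Z)` for all
`X, Y, Z` (the conclusion of `IsMetricFamilyOn.apply_varChrAt_of_flow`) is `piFlowAt G x`.
[cite: Topping2006, Prop. 2.3.1] -/
theorem eq_piFlowAt_of_forall (hi : (G x).IsInvertible) {T : E →L[ℝ] E →L[ℝ] E}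
    (h : ∀ X Y Z, G x (T X Y) Z = -(cov₂At G (ricAt G) x X Y Z + cov₂At G (ricAt G) x Y X Z
      - cov₂At G (ricAt G) x Z X Y)) : T = piFlowAt G x := by
  ext X Y
  rw [piFlowAt_apply, ← map_neg]
  refine (sharpAt_eq_of_forall hi fun Z ↦ ?_).symm
  rw [h X Y Z, _root_.neg_apply, kappaAt_apply]

/-- `‖κ(X,Y)‖ ≤ 3 ‖∇Ric‖ ‖X‖ ‖Y‖`. [folklore] -/
theorem norm_kappaAt_apply_le (X Y : E) :
    ‖kappaAt G x X Y‖ ≤ 3 * ‖cov₂At G (ricAt G) x‖ * ‖X‖ * ‖Y‖ := by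
  refine ContinuousLinearMap.opNorm_le_bound _ (by positivity) fun Z ↦ ?_
  rw [kappaAt_apply]
  have h1 := norm_map₃_le (cov₂At G (ricAt G) x) X Y Z
  have h2 := norm_map₃_le (cov₂At G (ricAt G) x) Y X Z
  have h3 := norm_map₃_le (cov₂At G (ricAt G) x) Z X Y
  calc ‖cov₂At G (ricAt G) x X Y Z + cov₂At G (ricAt G) x Y X Z - cov₂At G (ricAt G) x Z X Y‖
      ≤ ‖cov₂At G (ricAt G) x X Y Z‖ + ‖cov₂At G (ricAt G) x Y X Z‖
        + ‖cov₂At G (ricAt G) x Z X Y‖ := norm_sub_le_of_le (norm_add_le _ _) le_rfl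
    _ ≤ _ := by nlinarith [h1, h2, h3, norm_nonneg X, norm_nonneg Y, norm_nonneg Z,
        norm_nonneg (cov₂At G (ricAt G) x)]

variable {G' : E → E →L[ℝ] E →L[ℝ] ℝ}

/-- `‖(κ − κ')(X,Y)‖ ≤ 3 (‖dP‖ + 2‖Ric‖‖A‖ + 2‖Γ'‖‖P‖) ‖X‖ ‖Y‖`. [cite: Kotschwar2014, §1.1 (9)] -/
theorem norm_kappaAt_sub_apply_le (X Y : E) :
    ‖kappaAt G x X Y - kappaAt G' x X Y‖ ≤
      3 * (‖fderiv ℝ (ricAt G) x - fderiv ℝ (ricAt G') x‖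
        + 2 * ‖ricAt G x‖ * ‖chrAt G x - chrAt G' x‖
        + 2 * ‖chrAt G' x‖ * ‖ricAt G x - ricAt G' x‖) * ‖X‖ * ‖Y‖ := by
  refine ContinuousLinearMap.opNorm_le_bound _ (by positivity) fun Z ↦ ?_
  rw [_root_.sub_apply, kappaAt_apply, kappaAt_apply]
  have h1 := abs_cov₂At_ricAt_sub_le (G := G) (G' := G') (x := x) X Y Z
  have h2 := abs_cov₂At_ricAt_sub_le (G := G) (G' := G') (x := x) Y X Z
  have h3 := abs_cov₂At_ricAt_sub_le (G := G) (G' := G') (x := x) Z X Y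
  rw [← Real.norm_eq_abs] at h1 h2 h3
  calc ‖cov₂At G (ricAt G) x X Y Z + cov₂At G (ricAt G) x Y X Z - cov₂At G (ricAt G) x Z X Y
        - (cov₂At G' (ricAt G') x X Y Z + cov₂At G' (ricAt G') x Y X Z
          - cov₂At G' (ricAt G') x Z X Y)‖
      = ‖(cov₂At G (ricAt G) x X Y Z - cov₂At G' (ricAt G') x X Y Z)
          + (cov₂At G (ricAt G) x Y X Z - cov₂At G' (ricAt G') x Y X Z)
          - (cov₂At G (ricAt G) x Z X Y - cov₂At G' (ricAt G') x Z X Y)‖ := by ring_nf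
    _ ≤ ‖cov₂At G (ricAt G) x X Y Z - cov₂At G' (ricAt G') x X Y Z‖
          + ‖cov₂At G (ricAt G) x Y X Z - cov₂At G' (ricAt G') x Y X Z‖
          + ‖cov₂At G (ricAt G) x Z X Y - cov₂At G' (ricAt G') x Z X Y‖ :=
        norm_sub_le_of_le (norm_add_le _ _) le_rfl
    _ ≤ _ := by
        nlinarith [h1, h2, h3, norm_nonneg X, norm_nonneg Y, norm_nonneg Z,
          norm_nonneg (fderiv ℝ (ricAt G) x - fderiv ℝ (ricAt G') x), norm_nonneg (ricAt G x),
          norm_nonneg (chrAt G x - chrAt G' x), norm_nonneg (chrAt G' x),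
          norm_nonneg (ricAt G x - ricAt G' x)]

/-- **`Π − Π' = −(♯ − ♯')κ − ♯'(κ − κ')`** (telescoping). [cite: Kotschwar2014, §1.1 (6)] -/
theorem piFlowAt_sub_apply (X Y : E) :
    piFlowAt G x X Y - piFlowAt G' x X Y =
      -((sharpAt G x - sharpAt G' x) (kappaAt G x X Y))
        - sharpAt G' x (kappaAt G x X Y - kappaAt G' x X Y) := by
  simp only [piFlowAt_apply, _root_.sub_apply, map_sub]
  abel

/-- **The bound on `∂_t A = Π − Π'`** (Kotschwar 2014, (9):
`|∂_t A| ≤ C(|g̃⁻¹||∇̃R̃c||h| + |R̃c||A| + |∇S|)`, here with `S` the Ricci difference):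
`‖(Π − Π')(X,Y)‖ ≤ [3‖♯‖‖♯'‖‖∇Ric‖ ‖H‖ + 3‖♯'‖(‖dP‖ + 2‖Ric‖‖A‖ + 2‖Γ'‖‖P‖)] ‖X‖‖Y‖`.
[cite: Kotschwar2014, §1.1 (9)] -/
theorem norm_piFlowAt_sub_apply_le (hi : (G x).IsInvertible) (hi' : (G' x).IsInvertible) (X Y : E) :
    ‖piFlowAt G x X Y - piFlowAt G' x X Y‖ ≤
      (3 * ‖sharpAt G x‖ * ‖sharpAt G' x‖ * ‖cov₂At G (ricAt G) x‖ * ‖G x - G' x‖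
        + 3 * ‖sharpAt G' x‖ * (‖fderiv ℝ (ricAt G) x - fderiv ℝ (ricAt G') x‖
          + 2 * ‖ricAt G x‖ * ‖chrAt G x - chrAt G' x‖
          + 2 * ‖chrAt G' x‖ * ‖ricAt G x - ricAt G' x‖)) * ‖X‖ * ‖Y‖ := by
  rw [piFlowAt_sub_apply]
  have h1 : ‖(sharpAt G x - sharpAt G' x) (kappaAt G x X Y)‖ ≤
      (‖sharpAt G x‖ * ‖G x - G' x‖ * ‖sharpAt G' x‖) * (3 * ‖cov₂At G (ricAt G) x‖ * ‖X‖ * ‖Y‖) :=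
    (le_opNorm _ _).trans (mul_le_mul (norm_sharpAt_sub_le hi hi') (norm_kappaAt_apply_le X Y)
      (norm_nonneg _) (by positivity))
  have h2 : ‖sharpAt G' x (kappaAt G x X Y - kappaAt G' x X Y)‖ ≤
      ‖sharpAt G' x‖ * (3 * (‖fderiv ℝ (ricAt G) x - fderiv ℝ (ricAt G') x‖
        + 2 * ‖ricAt G x‖ * ‖chrAt G x - chrAt G' x‖
        + 2 * ‖chrAt G' x‖ * ‖ricAt G x - ricAt G' x‖) * ‖X‖ * ‖Y‖) :=
    (le_opNorm _ _).trans (mul_le_mul_of_nonneg_left (norm_kappaAt_sub_apply_le X Y) (norm_nonneg _))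
  calc ‖-((sharpAt G x - sharpAt G' x) (kappaAt G x X Y))
        - sharpAt G' x (kappaAt G x X Y - kappaAt G' x X Y)‖
      ≤ ‖(sharpAt G x - sharpAt G' x) (kappaAt G x X Y)‖
        + ‖sharpAt G' x (kappaAt G x X Y - kappaAt G' x X Y)‖ :=
        norm_sub_le_of_le (by rw [norm_neg]) le_rfl
    _ ≤ _ := by nlinarith [h1, h2]

end PiFlow

/-! ### Second-order differences: `R − R'` and the second covariant derivative operators -/

section SecondOrder

variable {G G' : E → E →L[ℝ] E →L[ℝ] ℝ} {V : Set E} {x : E}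

/-- Telescoping of the iterated Christoffel map:
`Γ(Γ(W,X),Y) − Γ'(Γ'(W,X),Y) = A(Γ(W,X),Y) + Γ'(A(W,X),Y)`, `A = Γ − Γ'`.
[cite: Kotschwar2014, §1.1 (7)] -/
theorem chrAt_chrAt_sub (W X Y : E) :
    chrAt G x (chrAt G x W X) Y - chrAt G' x (chrAt G' x W X) Y =
      (chrAt G x - chrAt G' x) (chrAt G x W X) Y + chrAt G' x ((chrAt G x - chrAt G' x) W X) Y := by
  simp only [_root_.sub_apply, map_sub]
  abel

/-- Telescoping of `Γ(X, Γ(W,Y)) − Γ'(X, Γ'(W,Y)) = A(X, Γ(W,Y)) + Γ'(X, A(W,Y))`.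
[cite: Kotschwar2014, §1.1 (7)] -/
theorem chrAt_chrAt_sub' (W X Y : E) :
    chrAt G x X (chrAt G x W Y) - chrAt G' x X (chrAt G' x W Y) =
      (chrAt G x - chrAt G' x) X (chrAt G x W Y) + chrAt G' x X ((chrAt G x - chrAt G' x) W Y) := by
  simp only [_root_.sub_apply, map_sub]
  abel

/-- **`R − R'`**: `R(X,Y)Z − R'(X,Y)Z = DA(X)(Y)Z − DA(Y)(X)Z + A(X,Γ(Y,Z)) + Γ'(X,A(Y,Z))
− A(Y,Γ(X,Z)) − Γ'(Y,A(X,Z))`, `A = Γ − Γ'`, `DA = DΓ − DΓ'` (the part linear in `DA` is the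
divergence part of Kotschwar's `div U`). [cite: Kotschwar2014, §1.1 (8)] -/
theorem riemAt_sub_apply (X Y Z : E) :
    riemAt G x X Y Z - riemAt G' x X Y Z =
      (fderiv ℝ (chrAt G) x - fderiv ℝ (chrAt G') x) X Y Z
        - (fderiv ℝ (chrAt G) x - fderiv ℝ (chrAt G') x) Y X Z
        + (chrAt G x - chrAt G' x) X (chrAt G x Y Z) + chrAt G' x X ((chrAt G x - chrAt G' x) Y Z)
        - (chrAt G x - chrAt G' x) Y (chrAt G x X Z) - chrAt G' x Y ((chrAt G x - chrAt G' x) X Z) := by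
  simp only [riemAt_apply, _root_.sub_apply, map_sub]
  abel

variable [CompleteSpace E]

/-- The **remainder of the difference of the second covariant derivative operators** of `G` and
`G'` on a fixed field of bilinear forms `β` (everything except the two terms containing
`DA = DΓ − DΓ'`): a sum of nineteen terms each containing one factor `A = Γ − Γ'`.
[cite: Kotschwar2014, §1.1 (8)] -/
def cov₃cov₂Rem (G G' : E → E →L[ℝ] E →L[ℝ] ℝ) (β : E → E →L[ℝ] E →L[ℝ] ℝ) (x W X Y Z : E) : ℝ :=
  -(fderiv ℝ β x W ((chrAt G x - chrAt G' x) X Y) Z)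
  - fderiv ℝ β x W Y ((chrAt G x - chrAt G' x) X Z)
  - fderiv ℝ β x ((chrAt G x - chrAt G' x) W X) Y Z
  - fderiv ℝ β x X ((chrAt G x - chrAt G' x) W Y) Z
  - fderiv ℝ β x X Y ((chrAt G x - chrAt G' x) W Z)
  + β x ((chrAt G x - chrAt G' x) (chrAt G x W X) Y) Z
  + β x (chrAt G' x ((chrAt G x - chrAt G' x) W X) Y) Z
  + β x Y ((chrAt G x - chrAt G' x) (chrAt G x W X) Z)
  + β x Y (chrAt G' x ((chrAt G x - chrAt G' x) W X) Z)
  + β x ((chrAt G x - chrAt G' x) X (chrAt G x W Y)) Z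
  + β x (chrAt G' x X ((chrAt G x - chrAt G' x) W Y)) Z
  + β x ((chrAt G x - chrAt G' x) W Y) (chrAt G x X Z)
  + β x (chrAt G' x W Y) ((chrAt G x - chrAt G' x) X Z)
  + β x ((chrAt G x - chrAt G' x) X Y) (chrAt G x W Z)
  + β x (chrAt G' x X Y) ((chrAt G x - chrAt G' x) W Z)
  + β x Y ((chrAt G x - chrAt G' x) X (chrAt G x W Z))
  + β x Y (chrAt G' x X ((chrAt G x - chrAt G' x) W Z))

/-- **Difference of the second covariant derivative operators on a fixed field**:
`(∇²_{W,X}β − ∇'²_{W,X}β)(Y,Z) = −β(DA(W)(X,Y),Z) − β(Y,DA(W)(X,Z)) + cov₃cov₂Rem`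
(`DA = DΓ − DΓ'`; the second derivatives of `β` cancel). [cite: Kotschwar2014, §1.1 (8)] -/
theorem IsMetricOn.cov₃At_cov₂At_sub (hG : IsMetricOn G V) (hG' : IsMetricOn G' V) (hx : x ∈ V)
    {β : E → E →L[ℝ] E →L[ℝ] ℝ} (hβ : ContDiffAt ℝ ∞ β x) (W X Y Z : E) :
    cov₃At G (cov₂At G β) x W X Y Z - cov₃At G' (cov₂At G' β) x W X Y Z =
      -(β x ((fderiv ℝ (chrAt G) x - fderiv ℝ (chrAt G') x) W X Y) Z)
        - β x Y ((fderiv ℝ (chrAt G) x - fderiv ℝ (chrAt G') x) W X Z)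
        + cov₃cov₂Rem G G' β x W X Y Z := by
  simp only [cov₃At_apply, hG.fderiv_cov₂At_apply hx hβ, hG'.fderiv_cov₂At_apply hx hβ, cov₂At_apply,
    cov₃cov₂Rem, _root_.sub_apply, map_sub]
  ring

omit [CompleteSpace E] in
/-- A product bound used repeatedly: `‖β u v‖ ≤ ‖β‖ ‖u‖ ‖v‖` combined with bounds on `u, v`.
[folklore] -/
theorem norm_map₂_le_of_le {F : Type*} [NormedAddCommGroup F] [NormedSpace ℝ F]
    (β : E →L[ℝ] E →L[ℝ] F) {u v : E} {cu cv : ℝ} (hu : ‖u‖ ≤ cu) (hv : ‖v‖ ≤ cv) :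
    ‖β u v‖ ≤ ‖β‖ * cu * cv := by
  have hcu : 0 ≤ cu := (norm_nonneg u).trans hu
  calc ‖β u v‖ ≤ ‖β‖ * ‖u‖ * ‖v‖ := le_opNorm₂ β u v
    _ ≤ ‖β‖ * cu * cv := by gcongr

omit [CompleteSpace E] in
/-- **Bound on the remainder**: with `N ≥ 1` a common bound for `‖β(x)‖, ‖Dβ(x)‖, ‖Γ‖, ‖Γ'‖`,
`|cov₃cov₂Rem| ≤ 17 N² ‖A‖ ‖W‖‖X‖‖Y‖‖Z‖`. [cite: Kotschwar2014, §1.1 (10)] -/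
theorem abs_cov₃cov₂Rem_le {β : E → E →L[ℝ] E →L[ℝ] ℝ} {N : ℝ} (hN : 1 ≤ N)
    (hβ0 : ‖β x‖ ≤ N) (hβ1 : ‖fderiv ℝ β x‖ ≤ N) (hΓ : ‖chrAt G x‖ ≤ N) (hΓ' : ‖chrAt G' x‖ ≤ N)
    (W X Y Z : E) :
    |cov₃cov₂Rem G G' β x W X Y Z| ≤ 17 * N ^ 2 * ‖chrAt G x - chrAt G' x‖ * ‖W‖ * ‖X‖ * ‖Y‖ * ‖Z‖ := by
  set A := chrAt G x - chrAt G' x with hA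
  set Γ := chrAt G x
  set Γ' := chrAt G' x
  set M := ‖A‖ * ‖W‖ * ‖X‖ * ‖Y‖ * ‖Z‖ with hM
  have hN0 : 0 ≤ N := zero_le_one.trans hN
  have hNN : N ≤ N ^ 2 := (pow_one N).symm.trans_le (pow_le_pow_right₀ hN (by norm_num))
  have hM0 : 0 ≤ M := by positivity
  -- elementary bounds on the building blocks
  have hAuv : ∀ u v, ‖A u v‖ ≤ ‖A‖ * ‖u‖ * ‖v‖ := fun u v ↦ le_opNorm₂ A u v
  have hΓuv : ∀ u v, ‖Γ u v‖ ≤ N * ‖u‖ * ‖v‖ := fun u v ↦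
    (le_opNorm₂ Γ u v).trans (by gcongr)
  have hΓ'uv : ∀ u v, ‖Γ' u v‖ ≤ N * ‖u‖ * ‖v‖ := fun u v ↦
    (le_opNorm₂ Γ' u v).trans (by gcongr)
  -- the five `Dβ` terms: `≤ N ‖A‖ WXYZ ≤ N² M`
  have d1 : ‖fderiv ℝ β x W (A X Y) Z‖ ≤ N ^ 2 * M := by
    calc ‖fderiv ℝ β x W (A X Y) Z‖ ≤ ‖fderiv ℝ β x‖ * ‖W‖ * ‖A X Y‖ * ‖Z‖ := norm_map₃_le _ _ _ _
      _ ≤ N * ‖W‖ * (‖A‖ * ‖X‖ * ‖Y‖) * ‖Z‖ := by gcongr; exact hAuv X Y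
      _ = N * M := by rw [hM]; ring
      _ ≤ N ^ 2 * M := by gcongr
  have d2 : ‖fderiv ℝ β x W Y (A X Z)‖ ≤ N ^ 2 * M := by
    calc ‖fderiv ℝ β x W Y (A X Z)‖ ≤ ‖fderiv ℝ β x‖ * ‖W‖ * ‖Y‖ * ‖A X Z‖ := norm_map₃_le _ _ _ _
      _ ≤ N * ‖W‖ * ‖Y‖ * (‖A‖ * ‖X‖ * ‖Z‖) := by gcongr; exact hAuv X Z
      _ = N * M := by rw [hM]; ring
      _ ≤ N ^ 2 * M := by gcongr
  have d3 : ‖fderiv ℝ β x (A W X) Y Z‖ ≤ N ^ 2 * M := by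
    calc ‖fderiv ℝ β x (A W X) Y Z‖ ≤ ‖fderiv ℝ β x‖ * ‖A W X‖ * ‖Y‖ * ‖Z‖ := norm_map₃_le _ _ _ _
      _ ≤ N * (‖A‖ * ‖W‖ * ‖X‖) * ‖Y‖ * ‖Z‖ := by gcongr; exact hAuv W X
      _ = N * M := by rw [hM]; ring
      _ ≤ N ^ 2 * M := by gcongr
  have d4 : ‖fderiv ℝ β x X (A W Y) Z‖ ≤ N ^ 2 * M := by
    calc ‖fderiv ℝ β x X (A W Y) Z‖ ≤ ‖fderiv ℝ β x‖ * ‖X‖ * ‖A W Y‖ * ‖Z‖ := norm_map₃_le _ _ _ _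
      _ ≤ N * ‖X‖ * (‖A‖ * ‖W‖ * ‖Y‖) * ‖Z‖ := by gcongr; exact hAuv W Y
      _ = N * M := by rw [hM]; ring
      _ ≤ N ^ 2 * M := by gcongr
  have d5 : ‖fderiv ℝ β x X Y (A W Z)‖ ≤ N ^ 2 * M := by
    calc ‖fderiv ℝ β x X Y (A W Z)‖ ≤ ‖fderiv ℝ β x‖ * ‖X‖ * ‖Y‖ * ‖A W Z‖ := norm_map₃_le _ _ _ _
      _ ≤ N * ‖X‖ * ‖Y‖ * (‖A‖ * ‖W‖ * ‖Z‖) := by gcongr; exact hAuv W Z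
      _ = N * M := by rw [hM]; ring
      _ ≤ N ^ 2 * M := by gcongr
  -- the twelve `β ∘ Γ ∘ A` terms: `≤ N · N‖A‖ WXYZ = N² M`
  have e1 : ‖β x (A (Γ W X) Y) Z‖ ≤ N ^ 2 * M := by
    calc ‖β x (A (Γ W X) Y) Z‖ ≤ ‖β x‖ * (‖A‖ * (N * ‖W‖ * ‖X‖) * ‖Y‖) * ‖Z‖ :=
          norm_map₂_le_of_le (β x) ((hAuv _ _).trans (by gcongr; exact hΓuv W X)) le_rfl
      _ ≤ N * (‖A‖ * (N * ‖W‖ * ‖X‖) * ‖Y‖) * ‖Z‖ := by gcongr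
      _ = N ^ 2 * M := by rw [hM]; ring
  have e2 : ‖β x (Γ' (A W X) Y) Z‖ ≤ N ^ 2 * M := by
    calc ‖β x (Γ' (A W X) Y) Z‖ ≤ ‖β x‖ * (N * (‖A‖ * ‖W‖ * ‖X‖) * ‖Y‖) * ‖Z‖ :=
          norm_map₂_le_of_le (β x) ((hΓ'uv _ _).trans (by gcongr; exact hAuv W X)) le_rfl
      _ ≤ N * (N * (‖A‖ * ‖W‖ * ‖X‖) * ‖Y‖) * ‖Z‖ := by gcongr
      _ = N ^ 2 * M := by rw [hM]; ring
  have e3 : ‖β x Y (A (Γ W X) Z)‖ ≤ N ^ 2 * M := by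
    calc ‖β x Y (A (Γ W X) Z)‖ ≤ ‖β x‖ * ‖Y‖ * (‖A‖ * (N * ‖W‖ * ‖X‖) * ‖Z‖) :=
          norm_map₂_le_of_le (β x) le_rfl ((hAuv _ _).trans (by gcongr; exact hΓuv W X))
      _ ≤ N * ‖Y‖ * (‖A‖ * (N * ‖W‖ * ‖X‖) * ‖Z‖) := by gcongr
      _ = N ^ 2 * M := by rw [hM]; ring
  have e4 : ‖β x Y (Γ' (A W X) Z)‖ ≤ N ^ 2 * M := by
    calc ‖β x Y (Γ' (A W X) Z)‖ ≤ ‖β x‖ * ‖Y‖ * (N * (‖A‖ * ‖W‖ * ‖X‖) * ‖Z‖) :=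
          norm_map₂_le_of_le (β x) le_rfl ((hΓ'uv _ _).trans (by gcongr; exact hAuv W X))
      _ ≤ N * ‖Y‖ * (N * (‖A‖ * ‖W‖ * ‖X‖) * ‖Z‖) := by gcongr
      _ = N ^ 2 * M := by rw [hM]; ring
  have e5 : ‖β x (A X (Γ W Y)) Z‖ ≤ N ^ 2 * M := by
    calc ‖β x (A X (Γ W Y)) Z‖ ≤ ‖β x‖ * (‖A‖ * ‖X‖ * (N * ‖W‖ * ‖Y‖)) * ‖Z‖ :=
          norm_map₂_le_of_le (β x) ((hAuv _ _).trans (by gcongr; exact hΓuv W Y)) le_rfl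
      _ ≤ N * (‖A‖ * ‖X‖ * (N * ‖W‖ * ‖Y‖)) * ‖Z‖ := by gcongr
      _ = N ^ 2 * M := by rw [hM]; ring
  have e6 : ‖β x (Γ' X (A W Y)) Z‖ ≤ N ^ 2 * M := by
    calc ‖β x (Γ' X (A W Y)) Z‖ ≤ ‖β x‖ * (N * ‖X‖ * (‖A‖ * ‖W‖ * ‖Y‖)) * ‖Z‖ :=
          norm_map₂_le_of_le (β x) ((hΓ'uv _ _).trans (by gcongr; exact hAuv W Y)) le_rfl
      _ ≤ N * (N * ‖X‖ * (‖A‖ * ‖W‖ * ‖Y‖)) * ‖Z‖ := by gcongr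
      _ = N ^ 2 * M := by rw [hM]; ring
  have e7 : ‖β x (A W Y) (Γ X Z)‖ ≤ N ^ 2 * M := by
    calc ‖β x (A W Y) (Γ X Z)‖ ≤ ‖β x‖ * (‖A‖ * ‖W‖ * ‖Y‖) * (N * ‖X‖ * ‖Z‖) :=
          norm_map₂_le_of_le (β x) (hAuv W Y) (hΓuv X Z)
      _ ≤ N * (‖A‖ * ‖W‖ * ‖Y‖) * (N * ‖X‖ * ‖Z‖) := by gcongr
      _ = N ^ 2 * M := by rw [hM]; ring
  have e8 : ‖β x (Γ' W Y) (A X Z)‖ ≤ N ^ 2 * M := by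
    calc ‖β x (Γ' W Y) (A X Z)‖ ≤ ‖β x‖ * (N * ‖W‖ * ‖Y‖) * (‖A‖ * ‖X‖ * ‖Z‖) :=
          norm_map₂_le_of_le (β x) (hΓ'uv W Y) (hAuv X Z)
      _ ≤ N * (N * ‖W‖ * ‖Y‖) * (‖A‖ * ‖X‖ * ‖Z‖) := by gcongr
      _ = N ^ 2 * M := by rw [hM]; ring
  have e9 : ‖β x (A X Y) (Γ W Z)‖ ≤ N ^ 2 * M := by
    calc ‖β x (A X Y) (Γ W Z)‖ ≤ ‖β x‖ * (‖A‖ * ‖X‖ * ‖Y‖) * (N * ‖W‖ * ‖Z‖) :=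
          norm_map₂_le_of_le (β x) (hAuv X Y) (hΓuv W Z)
      _ ≤ N * (‖A‖ * ‖X‖ * ‖Y‖) * (N * ‖W‖ * ‖Z‖) := by gcongr
      _ = N ^ 2 * M := by rw [hM]; ring
  have e10 : ‖β x (Γ' X Y) (A W Z)‖ ≤ N ^ 2 * M := by
    calc ‖β x (Γ' X Y) (A W Z)‖ ≤ ‖β x‖ * (N * ‖X‖ * ‖Y‖) * (‖A‖ * ‖W‖ * ‖Z‖) :=
          norm_map₂_le_of_le (β x) (hΓ'uv X Y) (hAuv W Z)
      _ ≤ N * (N * ‖X‖ * ‖Y‖) * (‖A‖ * ‖W‖ * ‖Z‖) := by gcongr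
      _ = N ^ 2 * M := by rw [hM]; ring
  have e11 : ‖β x Y (A X (Γ W Z))‖ ≤ N ^ 2 * M := by
    calc ‖β x Y (A X (Γ W Z))‖ ≤ ‖β x‖ * ‖Y‖ * (‖A‖ * ‖X‖ * (N * ‖W‖ * ‖Z‖)) :=
          norm_map₂_le_of_le (β x) le_rfl ((hAuv _ _).trans (by gcongr; exact hΓuv W Z))
      _ ≤ N * ‖Y‖ * (‖A‖ * ‖X‖ * (N * ‖W‖ * ‖Z‖)) := by gcongr
      _ = N ^ 2 * M := by rw [hM]; ring
  have e12 : ‖β x Y (Γ' X (A W Z))‖ ≤ N ^ 2 * M := by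
    calc ‖β x Y (Γ' X (A W Z))‖ ≤ ‖β x‖ * ‖Y‖ * (N * ‖X‖ * (‖A‖ * ‖W‖ * ‖Z‖)) :=
          norm_map₂_le_of_le (β x) le_rfl ((hΓ'uv _ _).trans (by gcongr; exact hAuv W Z))
      _ ≤ N * ‖Y‖ * (N * ‖X‖ * (‖A‖ * ‖W‖ * ‖Z‖)) := by gcongr
      _ = N ^ 2 * M := by rw [hM]; ring
  rw [← Real.norm_eq_abs]
  have key : ‖cov₃cov₂Rem G G' β x W X Y Z‖ ≤ 17 * (N ^ 2 * M) := by
    unfold cov₃cov₂Rem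
    refine (norm_add_le_of_le (norm_add_le_of_le (norm_add_le_of_le (norm_add_le_of_le
      (norm_add_le_of_le (norm_add_le_of_le (norm_add_le_of_le (norm_add_le_of_le
      (norm_add_le_of_le (norm_add_le_of_le (norm_add_le_of_le (norm_add_le_of_le
      (norm_sub_le_of_le (norm_sub_le_of_le (norm_sub_le_of_le (norm_sub_le_of_le
      ((norm_neg _).trans_le d1) d2) d3) d4) d5) e1) e2) e3) e4) e5) e6) e7) e8) e9) e10) e11) e12).trans
      ?_
    linarith
  calc ‖cov₃cov₂Rem G G' β x W X Y Z‖ ≤ 17 * (N ^ 2 * M) := key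
    _ = _ := by rw [hM]; ring

end SecondOrder

/-! ### The difference fields `P = Ric − Ric'`, `A = Γ − Γ'` as functions of the point -/

section DiffFields

variable (G G' : E → E →L[ℝ] E →L[ℝ] ℝ)

/-- The **Ricci difference field** `P(y) = Ric(G)_y − Ric(G')_y`. [cite: Kotschwar2014, §1.1] -/
def ricDiff [FiniteDimensional ℝ E] (y : E) : E →L[ℝ] E →L[ℝ] ℝ := ricAt G y - ricAt G' y

/-- The **connection difference field** `A(y) = Γ(G)_y − Γ(G')_y` (a tensor: the difference of
two connections; Kotschwar 2014, `A = ∇ − ∇̃`). [cite: Kotschwar2014, §1.1] -/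
def chrDiff (y : E) : E →L[ℝ] E →L[ℝ] E := chrAt G y - chrAt G' y

/-- Unfolding lemma for `ricDiff`. [folklore] -/
@[simp] theorem ricDiff_apply [FiniteDimensional ℝ E] (y : E) :
    ricDiff G G' y = ricAt G y - ricAt G' y := rfl

/-- Unfolding lemma for `chrDiff`. [folklore] -/
@[simp] theorem chrDiff_apply (y : E) : chrDiff G G' y = chrAt G y - chrAt G' y := rfl

variable {G G'} {V : Set E} {x : E} [CompleteSpace E]

/-- `P` is `C^∞` on `V`. [folklore] -/
theorem IsMetricOn.contDiffOn_ricDiff [FiniteDimensional ℝ E] (hG : IsMetricOn G V)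
    (hG' : IsMetricOn G' V) : ContDiffOn ℝ ∞ (ricDiff G G') V :=
  hG.contDiffOn_ricAt.sub hG'.contDiffOn_ricAt

/-- `A` is `C^∞` on `V`. [folklore] -/
theorem IsMetricOn.contDiffOn_chrDiff (hG : IsMetricOn G V) (hG' : IsMetricOn G' V) :
    ContDiffOn ℝ ∞ (chrDiff G G') V :=
  hG.contDiffOn_chrAt.sub hG'.contDiffOn_chrAt

/-- `DP = DRic − DRic'` at the points of `V`. [folklore] -/
theorem IsMetricOn.fderiv_ricDiff [FiniteDimensional ℝ E] (hG : IsMetricOn G V) (hG' : IsMetricOn G' V)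
    (hx : x ∈ V) : fderiv ℝ (ricDiff G G') x = fderiv ℝ (ricAt G) x - fderiv ℝ (ricAt G') x :=
  fderiv_sub (hG.differentiableAt_ricAt hx) (hG'.differentiableAt_ricAt hx)

/-- `DA = DΓ − DΓ'` at the points of `V`. [folklore] -/
theorem IsMetricOn.fderiv_chrDiff (hG : IsMetricOn G V) (hG' : IsMetricOn G' V) (hx : x ∈ V) :
    fderiv ℝ (chrDiff G G') x = fderiv ℝ (chrAt G) x - fderiv ℝ (chrAt G') x :=
  fderiv_sub (hG.differentiableAt_chrAt hx) (hG'.differentiableAt_chrAt hx)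

end DiffFields

/-! ### The Laplacian difference -/

section Laplacian

variable {ι : Type*} [Fintype ι] [FiniteDimensional ℝ E] [CompleteSpace E] (b : Basis ι ℝ E)
  {G G' : E → E →L[ℝ] E →L[ℝ] ℝ} {V : Set E} {x : E}

omit [Fintype ι] [FiniteDimensional ℝ E] in
/-- **Linearity of `β ↦ ∇²β` in the field**: `∇²(β₁ − β₂) = ∇²β₁ − ∇²β₂` at `x`, for fields
smooth on `V`. [folklore] -/
theorem IsMetricOn.cov₃At_cov₂At_field_sub (hG : IsMetricOn G V) (hx : x ∈ V)
    {β₁ β₂ : E → E →L[ℝ] E →L[ℝ] ℝ} (h₁ : ContDiffOn ℝ ∞ β₁ V) (h₂ : ContDiffOn ℝ ∞ β₂ V) :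
    cov₃At G (cov₂At G (fun y ↦ β₁ y - β₂ y)) x =
      cov₃At G (cov₂At G β₁) x - cov₃At G (cov₂At G β₂) x := by
  have hd : ∀ {β : E → E →L[ℝ] E →L[ℝ] ℝ}, ContDiffOn ℝ ∞ β V → ∀ y ∈ V, DifferentiableAt ℝ β y :=
    fun hβ y hy ↦ ((hβ y hy).contDiffAt (hG.mem_nhds hy)).differentiableAt (by simp)
  have heq : cov₂At G (fun y ↦ β₁ y - β₂ y) =ᶠ[𝓝 x] fun y ↦ cov₂At G β₁ y - cov₂At G β₂ y := by
    filter_upwards [hG.mem_nhds hx] with y hy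
    ext W Y Z
    simp only [cov₂At_apply, fderiv_fun_sub (hd h₁ y hy) (hd h₂ y hy), _root_.sub_apply]
    ring
  rw [cov₃At_congr heq, cov₃At_sub (hG.differentiableAt_cov₂At hx ((h₁ x hx).contDiffAt (hG.mem_nhds hx)))
    (hG.differentiableAt_cov₂At hx ((h₂ x hx).contDiffAt (hG.mem_nhds hx)))]

/-- **The Laplacian difference, telescoped**:
`Δ_G Ric − Δ_{G'} Ric' = Σ g^{ij} ∇²_{ij}P + Σ (g^{ij} − g'^{ij}) ∇²_{ij}Ric' + Σ g'^{ij} (∇²_{ij} − ∇'²_{ij}) Ric'`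
with `P = Ric − Ric'` (`ricDiff`). [cite: Kotschwar2014, §1.1 (8)] -/
theorem IsMetricOn.lapBilinAt_ricAt_sub (hG : IsMetricOn G V) (hG' : IsMetricOn G' V) (hx : x ∈ V)
    (Y Z : E) :
    lapBilinAt G (ricAt G) x Y Z - lapBilinAt G' (ricAt G') x Y Z =
      (∑ i, ∑ j, ginv G b x i j * cov₃At G (cov₂At G (ricDiff G G')) x (b i) (b j) Y Z)
      + (∑ i, ∑ j, (ginv G b x i j - ginv G' b x i j) *
          cov₃At G (cov₂At G (ricAt G')) x (b i) (b j) Y Z)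
      + ∑ i, ∑ j, ginv G' b x i j * (cov₃At G (cov₂At G (ricAt G')) x (b i) (b j) Y Z
          - cov₃At G' (cov₂At G' (ricAt G')) x (b i) (b j) Y Z) := by
  have hlin := hG.cov₃At_cov₂At_field_sub hx hG.contDiffOn_ricAt hG'.contDiffOn_ricAt
  rw [lapBilinAt_apply_eq_sum G (ricAt G) b, lapBilinAt_apply_eq_sum G' (ricAt G') b,
    show ricDiff G G' = fun y ↦ ricAt G y - ricAt G' y from rfl, hlin,
    ← Finset.sum_sub_distrib, ← Finset.sum_add_distrib, ← Finset.sum_add_distrib]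
  refine Finset.sum_congr rfl fun i _ ↦ ?_
  rw [← Finset.sum_sub_distrib, ← Finset.sum_add_distrib, ← Finset.sum_add_distrib]
  refine Finset.sum_congr rfl fun j _ ↦ ?_
  simp only [_root_.sub_apply]
  ring

/-- The lower-order part of `∇²_{W,X} P (Y,Z)` (everything except `D²P(W,X,Y,Z)`): thirteen
terms, each containing one factor `P(x)` or `DP(x)`. [cite: Kotschwar2014, §1.1 (8)] -/
def lapPRem (G G' : E → E →L[ℝ] E →L[ℝ] ℝ) (x W X Y Z : E) : ℝ :=
  -(fderiv ℝ (ricDiff G G') x W (chrAt G x X Y) Z)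
  - ricDiff G G' x (fderiv ℝ (chrAt G) x W X Y) Z
  - fderiv ℝ (ricDiff G G') x W Y (chrAt G x X Z)
  - ricDiff G G' x Y (fderiv ℝ (chrAt G) x W X Z)
  - fderiv ℝ (ricDiff G G') x (chrAt G x W X) Y Z
  + ricDiff G G' x (chrAt G x (chrAt G x W X) Y) Z
  + ricDiff G G' x Y (chrAt G x (chrAt G x W X) Z)
  - fderiv ℝ (ricDiff G G') x X (chrAt G x W Y) Z
  + ricDiff G G' x (chrAt G x X (chrAt G x W Y)) Z
  + ricDiff G G' x (chrAt G x W Y) (chrAt G x X Z)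
  - fderiv ℝ (ricDiff G G') x X Y (chrAt G x W Z)
  + ricDiff G G' x (chrAt G x X Y) (chrAt G x W Z)
  + ricDiff G G' x Y (chrAt G x X (chrAt G x W Z))

/-- **`∇²_{W,X} P (Y,Z) = D²P(W,X,Y,Z) + lapPRem`**: the principal part of the Laplacian of the
Ricci difference is the coordinate second derivative. [cite: Kotschwar2014, §1.1 (8)] -/
theorem IsMetricOn.cov₃At_cov₂At_ricDiff (hG : IsMetricOn G V) (hG' : IsMetricOn G' V) (hx : x ∈ V)
    (W X Y Z : E) :
    cov₃At G (cov₂At G (ricDiff G G')) x W X Y Z =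
      fderiv ℝ (fderiv ℝ (ricDiff G G')) x W X Y Z + lapPRem G G' x W X Y Z := by
  have hP : ContDiffAt ℝ ∞ (ricDiff G G') x :=
    ((hG.contDiffOn_ricDiff hG') x hx).contDiffAt (hG.mem_nhds hx)
  simp only [cov₃At_apply, hG.fderiv_cov₂At_apply hx hP, cov₂At_apply, lapPRem]
  ring

omit [Fintype ι] [CompleteSpace E] in
/-- **Bound on `lapPRem`**: with `N ≥ 1` bounding `‖Γ‖, ‖DΓ‖`,
`|lapPRem| ≤ 13 N² (‖P‖ + ‖DP‖) ‖W‖‖X‖‖Y‖‖Z‖`. [cite: Kotschwar2014, §1.1 (10)] -/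
theorem abs_lapPRem_le {N : ℝ} (hN : 1 ≤ N) (hΓ : ‖chrAt G x‖ ≤ N) (hDΓ : ‖fderiv ℝ (chrAt G) x‖ ≤ N)
    (W X Y Z : E) :
    |lapPRem G G' x W X Y Z| ≤ 13 * N ^ 2 * (‖ricDiff G G' x‖ + ‖fderiv ℝ (ricDiff G G') x‖)
      * ‖W‖ * ‖X‖ * ‖Y‖ * ‖Z‖ := by
  set P := ricDiff G G' x
  set DP := fderiv ℝ (ricDiff G G') x
  set Γ := chrAt G x
  set DΓ := fderiv ℝ (chrAt G) x
  set M := (‖P‖ + ‖DP‖) * ‖W‖ * ‖X‖ * ‖Y‖ * ‖Z‖ with hM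
  have hN0 : 0 ≤ N := zero_le_one.trans hN
  have hNN : N ≤ N ^ 2 := (pow_one N).symm.trans_le (pow_le_pow_right₀ hN (by norm_num))
  have h1N : (1 : ℝ) ≤ N ^ 2 := hN.trans hNN
  have hP0 : ‖P‖ ≤ ‖P‖ + ‖DP‖ := le_add_of_nonneg_right (norm_nonneg _)
  have hDP0 : ‖DP‖ ≤ ‖P‖ + ‖DP‖ := le_add_of_nonneg_left (norm_nonneg _)
  have hΓuv : ∀ u v, ‖Γ u v‖ ≤ N * ‖u‖ * ‖v‖ := fun u v ↦ (le_opNorm₂ Γ u v).trans (by gcongr)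
  have hDΓuvw : ∀ u v w, ‖DΓ u v w‖ ≤ N * ‖u‖ * ‖v‖ * ‖w‖ := fun u v w ↦
    (norm_map₃_le DΓ u v w).trans (by gcongr)
  have hΓΓ : ∀ u v w, ‖Γ (Γ u v) w‖ ≤ N ^ 2 * ‖u‖ * ‖v‖ * ‖w‖ := fun u v w ↦ by
    calc ‖Γ (Γ u v) w‖ ≤ N * (N * ‖u‖ * ‖v‖) * ‖w‖ := by
          refine (le_opNorm₂ Γ _ _).trans ?_; gcongr; exact hΓuv u v
      _ = N ^ 2 * ‖u‖ * ‖v‖ * ‖w‖ := by ring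
  have hΓΓ' : ∀ u v w, ‖Γ u (Γ v w)‖ ≤ N ^ 2 * ‖u‖ * ‖v‖ * ‖w‖ := fun u v w ↦ by
    calc ‖Γ u (Γ v w)‖ ≤ N * ‖u‖ * (N * ‖v‖ * ‖w‖) := by
          refine (le_opNorm₂ Γ _ _).trans ?_; gcongr; exact hΓuv v w
      _ = N ^ 2 * ‖u‖ * ‖v‖ * ‖w‖ := by ring
  -- the thirteen terms, each `≤ N² M`
  have t1 : ‖DP W (Γ X Y) Z‖ ≤ N ^ 2 * M := by
    calc ‖DP W (Γ X Y) Z‖ ≤ ‖DP‖ * ‖W‖ * (N * ‖X‖ * ‖Y‖) * ‖Z‖ := by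
          refine (norm_map₃_le DP _ _ _).trans ?_; gcongr; exact hΓuv X Y
      _ = N * (‖DP‖ * ‖W‖ * ‖X‖ * ‖Y‖ * ‖Z‖) := by ring
      _ ≤ N ^ 2 * M := by rw [hM]; gcongr
  have t2 : ‖P (DΓ W X Y) Z‖ ≤ N ^ 2 * M := by
    calc ‖P (DΓ W X Y) Z‖ ≤ ‖P‖ * (N * ‖W‖ * ‖X‖ * ‖Y‖) * ‖Z‖ :=
          norm_map₂_le_of_le P (hDΓuvw W X Y) le_rfl
      _ = N * (‖P‖ * ‖W‖ * ‖X‖ * ‖Y‖ * ‖Z‖) := by ring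
      _ ≤ N ^ 2 * M := by rw [hM]; gcongr
  have t3 : ‖DP W Y (Γ X Z)‖ ≤ N ^ 2 * M := by
    calc ‖DP W Y (Γ X Z)‖ ≤ ‖DP‖ * ‖W‖ * ‖Y‖ * (N * ‖X‖ * ‖Z‖) := by
          refine (norm_map₃_le DP _ _ _).trans ?_; gcongr; exact hΓuv X Z
      _ = N * (‖DP‖ * ‖W‖ * ‖X‖ * ‖Y‖ * ‖Z‖) := by ring
      _ ≤ N ^ 2 * M := by rw [hM]; gcongr
  have t4 : ‖P Y (DΓ W X Z)‖ ≤ N ^ 2 * M := by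
    calc ‖P Y (DΓ W X Z)‖ ≤ ‖P‖ * ‖Y‖ * (N * ‖W‖ * ‖X‖ * ‖Z‖) :=
          norm_map₂_le_of_le P le_rfl (hDΓuvw W X Z)
      _ = N * (‖P‖ * ‖W‖ * ‖X‖ * ‖Y‖ * ‖Z‖) := by ring
      _ ≤ N ^ 2 * M := by rw [hM]; gcongr
  have t5 : ‖DP (Γ W X) Y Z‖ ≤ N ^ 2 * M := by
    calc ‖DP (Γ W X) Y Z‖ ≤ ‖DP‖ * (N * ‖W‖ * ‖X‖) * ‖Y‖ * ‖Z‖ := by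
          refine (norm_map₃_le DP _ _ _).trans ?_; gcongr; exact hΓuv W X
      _ = N * (‖DP‖ * ‖W‖ * ‖X‖ * ‖Y‖ * ‖Z‖) := by ring
      _ ≤ N ^ 2 * M := by rw [hM]; gcongr
  have t6 : ‖P (Γ (Γ W X) Y) Z‖ ≤ N ^ 2 * M := by
    calc ‖P (Γ (Γ W X) Y) Z‖ ≤ ‖P‖ * (N ^ 2 * ‖W‖ * ‖X‖ * ‖Y‖) * ‖Z‖ :=
          norm_map₂_le_of_le P (hΓΓ W X Y) le_rfl
      _ = N ^ 2 * (‖P‖ * ‖W‖ * ‖X‖ * ‖Y‖ * ‖Z‖) := by ring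
      _ ≤ N ^ 2 * M := by rw [hM]; gcongr
  have t7 : ‖P Y (Γ (Γ W X) Z)‖ ≤ N ^ 2 * M := by
    calc ‖P Y (Γ (Γ W X) Z)‖ ≤ ‖P‖ * ‖Y‖ * (N ^ 2 * ‖W‖ * ‖X‖ * ‖Z‖) :=
          norm_map₂_le_of_le P le_rfl (hΓΓ W X Z)
      _ = N ^ 2 * (‖P‖ * ‖W‖ * ‖X‖ * ‖Y‖ * ‖Z‖) := by ring
      _ ≤ N ^ 2 * M := by rw [hM]; gcongr
  have t8 : ‖DP X (Γ W Y) Z‖ ≤ N ^ 2 * M := by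
    calc ‖DP X (Γ W Y) Z‖ ≤ ‖DP‖ * ‖X‖ * (N * ‖W‖ * ‖Y‖) * ‖Z‖ := by
          refine (norm_map₃_le DP _ _ _).trans ?_; gcongr; exact hΓuv W Y
      _ = N * (‖DP‖ * ‖W‖ * ‖X‖ * ‖Y‖ * ‖Z‖) := by ring
      _ ≤ N ^ 2 * M := by rw [hM]; gcongr
  have t9 : ‖P (Γ X (Γ W Y)) Z‖ ≤ N ^ 2 * M := by
    calc ‖P (Γ X (Γ W Y)) Z‖ ≤ ‖P‖ * (N ^ 2 * ‖X‖ * ‖W‖ * ‖Y‖) * ‖Z‖ :=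
          norm_map₂_le_of_le P (hΓΓ' X W Y) le_rfl
      _ = N ^ 2 * (‖P‖ * ‖W‖ * ‖X‖ * ‖Y‖ * ‖Z‖) := by ring
      _ ≤ N ^ 2 * M := by rw [hM]; gcongr
  have t10 : ‖P (Γ W Y) (Γ X Z)‖ ≤ N ^ 2 * M := by
    calc ‖P (Γ W Y) (Γ X Z)‖ ≤ ‖P‖ * (N * ‖W‖ * ‖Y‖) * (N * ‖X‖ * ‖Z‖) :=
          norm_map₂_le_of_le P (hΓuv W Y) (hΓuv X Z)
      _ = N ^ 2 * (‖P‖ * ‖W‖ * ‖X‖ * ‖Y‖ * ‖Z‖) := by ring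
      _ ≤ N ^ 2 * M := by rw [hM]; gcongr
  have t11 : ‖DP X Y (Γ W Z)‖ ≤ N ^ 2 * M := by
    calc ‖DP X Y (Γ W Z)‖ ≤ ‖DP‖ * ‖X‖ * ‖Y‖ * (N * ‖W‖ * ‖Z‖) := by
          refine (norm_map₃_le DP _ _ _).trans ?_; gcongr; exact hΓuv W Z
      _ = N * (‖DP‖ * ‖W‖ * ‖X‖ * ‖Y‖ * ‖Z‖) := by ring
      _ ≤ N ^ 2 * M := by rw [hM]; gcongr
  have t12 : ‖P (Γ X Y) (Γ W Z)‖ ≤ N ^ 2 * M := by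
    calc ‖P (Γ X Y) (Γ W Z)‖ ≤ ‖P‖ * (N * ‖X‖ * ‖Y‖) * (N * ‖W‖ * ‖Z‖) :=
          norm_map₂_le_of_le P (hΓuv X Y) (hΓuv W Z)
      _ = N ^ 2 * (‖P‖ * ‖W‖ * ‖X‖ * ‖Y‖ * ‖Z‖) := by ring
      _ ≤ N ^ 2 * M := by rw [hM]; gcongr
  have t13 : ‖P Y (Γ X (Γ W Z))‖ ≤ N ^ 2 * M := by
    calc ‖P Y (Γ X (Γ W Z))‖ ≤ ‖P‖ * ‖Y‖ * (N ^ 2 * ‖X‖ * ‖W‖ * ‖Z‖) :=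
          norm_map₂_le_of_le P le_rfl (hΓΓ' X W Z)
      _ = N ^ 2 * (‖P‖ * ‖W‖ * ‖X‖ * ‖Y‖ * ‖Z‖) := by ring
      _ ≤ N ^ 2 * M := by rw [hM]; gcongr
  rw [← Real.norm_eq_abs]
  have key : ‖lapPRem G G' x W X Y Z‖ ≤ 13 * (N ^ 2 * M) := by
    unfold lapPRem
    refine (norm_add_le_of_le (norm_add_le_of_le (norm_sub_le_of_le (norm_add_le_of_le
      (norm_add_le_of_le (norm_sub_le_of_le (norm_add_le_of_le (norm_add_le_of_le
      (norm_sub_le_of_le (norm_sub_le_of_le (norm_sub_le_of_le (norm_sub_le_of_le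
      ((norm_neg _).trans_le t1) t2) t3) t4) t5) t6) t7) t8) t9) t10) t11) t12) t13).trans ?_
    linarith
  calc ‖lapPRem G G' x W X Y Z‖ ≤ 13 * (N ^ 2 * M) := key
    _ = _ := by rw [hM]; ring

omit [Fintype ι] [FiniteDimensional ℝ E] in
/-- **Bound on the full second covariant derivative of a background field**: with `N ≥ 1`
bounding `‖β(x)‖, ‖Dβ(x)‖, ‖D²β(x)‖, ‖Γ‖, ‖DΓ‖`, `|∇²_{W,X}β(Y,Z)| ≤ 14 N³ ‖W‖‖X‖‖Y‖‖Z‖`.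
[cite: Kotschwar2014, §1.1 (10)] -/
theorem IsMetricOn.abs_cov₃At_cov₂At_le (hG : IsMetricOn G V) (hx : x ∈ V) {β : E → E →L[ℝ] E →L[ℝ] ℝ}
    (hβ : ContDiffAt ℝ ∞ β x) {N : ℝ} (hN : 1 ≤ N) (hβ0 : ‖β x‖ ≤ N) (hβ1 : ‖fderiv ℝ β x‖ ≤ N)
    (hβ2 : ‖fderiv ℝ (fderiv ℝ β) x‖ ≤ N) (hΓ : ‖chrAt G x‖ ≤ N) (hDΓ : ‖fderiv ℝ (chrAt G) x‖ ≤ N)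
    (W X Y Z : E) :
    |cov₃At G (cov₂At G β) x W X Y Z| ≤ 14 * N ^ 3 * ‖W‖ * ‖X‖ * ‖Y‖ * ‖Z‖ := by
  set Γ := chrAt G x
  set DΓ := fderiv ℝ (chrAt G) x
  set M := ‖W‖ * ‖X‖ * ‖Y‖ * ‖Z‖ with hM
  have hN0 : 0 ≤ N := zero_le_one.trans hN
  have hN1 : N ≤ N ^ 3 := (pow_one N).symm.trans_le (pow_le_pow_right₀ hN (by norm_num))
  have hN2 : N ^ 2 ≤ N ^ 3 := pow_le_pow_right₀ hN (by norm_num)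
  have hΓuv : ∀ u v, ‖Γ u v‖ ≤ N * ‖u‖ * ‖v‖ := fun u v ↦ (le_opNorm₂ Γ u v).trans (by gcongr)
  have hDΓuvw : ∀ u v w, ‖DΓ u v w‖ ≤ N * ‖u‖ * ‖v‖ * ‖w‖ := fun u v w ↦
    (norm_map₃_le DΓ u v w).trans (by gcongr)
  have hΓΓ : ∀ u v w, ‖Γ (Γ u v) w‖ ≤ N ^ 2 * ‖u‖ * ‖v‖ * ‖w‖ := fun u v w ↦ by
    calc ‖Γ (Γ u v) w‖ ≤ N * (N * ‖u‖ * ‖v‖) * ‖w‖ := by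
          refine (le_opNorm₂ Γ _ _).trans ?_; gcongr; exact hΓuv u v
      _ = N ^ 2 * ‖u‖ * ‖v‖ * ‖w‖ := by ring
  have hΓΓ' : ∀ u v w, ‖Γ u (Γ v w)‖ ≤ N ^ 2 * ‖u‖ * ‖v‖ * ‖w‖ := fun u v w ↦ by
    calc ‖Γ u (Γ v w)‖ ≤ N * ‖u‖ * (N * ‖v‖ * ‖w‖) := by
          refine (le_opNorm₂ Γ _ _).trans ?_; gcongr; exact hΓuv v w
      _ = N ^ 2 * ‖u‖ * ‖v‖ * ‖w‖ := by ring
  have s0 : ‖fderiv ℝ (fderiv ℝ β) x W X Y Z‖ ≤ N ^ 3 * M := by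
    calc ‖fderiv ℝ (fderiv ℝ β) x W X Y Z‖ ≤ ‖fderiv ℝ (fderiv ℝ β) x‖ * ‖W‖ * ‖X‖ * ‖Y‖ * ‖Z‖ :=
          norm_map₄_le _ W X Y Z
      _ ≤ N ^ 3 * ‖W‖ * ‖X‖ * ‖Y‖ * ‖Z‖ := by gcongr; exact hβ2.trans hN1
      _ = N ^ 3 * M := by rw [hM]; ring
  have s1 : ‖fderiv ℝ β x W (Γ X Y) Z‖ ≤ N ^ 3 * M := by
    calc ‖fderiv ℝ β x W (Γ X Y) Z‖ ≤ N * ‖W‖ * (N * ‖X‖ * ‖Y‖) * ‖Z‖ := by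
          refine (norm_map₃_le _ _ _ _).trans ?_; gcongr; exact hΓuv X Y
      _ = N ^ 2 * M := by rw [hM]; ring
      _ ≤ N ^ 3 * M := by gcongr
  have s2 : ‖β x (DΓ W X Y) Z‖ ≤ N ^ 3 * M := by
    calc ‖β x (DΓ W X Y) Z‖ ≤ ‖β x‖ * (N * ‖W‖ * ‖X‖ * ‖Y‖) * ‖Z‖ :=
          norm_map₂_le_of_le _ (hDΓuvw W X Y) le_rfl
      _ ≤ N * (N * ‖W‖ * ‖X‖ * ‖Y‖) * ‖Z‖ := by gcongr
      _ = N ^ 2 * M := by rw [hM]; ring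
      _ ≤ N ^ 3 * M := by gcongr
  have s3 : ‖fderiv ℝ β x W Y (Γ X Z)‖ ≤ N ^ 3 * M := by
    calc ‖fderiv ℝ β x W Y (Γ X Z)‖ ≤ N * ‖W‖ * ‖Y‖ * (N * ‖X‖ * ‖Z‖) := by
          refine (norm_map₃_le _ _ _ _).trans ?_; gcongr; exact hΓuv X Z
      _ = N ^ 2 * M := by rw [hM]; ring
      _ ≤ N ^ 3 * M := by gcongr
  have s4 : ‖β x Y (DΓ W X Z)‖ ≤ N ^ 3 * M := by
    calc ‖β x Y (DΓ W X Z)‖ ≤ ‖β x‖ * ‖Y‖ * (N * ‖W‖ * ‖X‖ * ‖Z‖) :=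
          norm_map₂_le_of_le _ le_rfl (hDΓuvw W X Z)
      _ ≤ N * ‖Y‖ * (N * ‖W‖ * ‖X‖ * ‖Z‖) := by gcongr
      _ = N ^ 2 * M := by rw [hM]; ring
      _ ≤ N ^ 3 * M := by gcongr
  have s5 : ‖fderiv ℝ β x (Γ W X) Y Z‖ ≤ N ^ 3 * M := by
    calc ‖fderiv ℝ β x (Γ W X) Y Z‖ ≤ N * (N * ‖W‖ * ‖X‖) * ‖Y‖ * ‖Z‖ := by
          refine (norm_map₃_le _ _ _ _).trans ?_; gcongr; exact hΓuv W X
      _ = N ^ 2 * M := by rw [hM]; ring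
      _ ≤ N ^ 3 * M := by gcongr
  have s6 : ‖β x (Γ (Γ W X) Y) Z‖ ≤ N ^ 3 * M := by
    calc ‖β x (Γ (Γ W X) Y) Z‖ ≤ ‖β x‖ * (N ^ 2 * ‖W‖ * ‖X‖ * ‖Y‖) * ‖Z‖ :=
          norm_map₂_le_of_le _ (hΓΓ W X Y) le_rfl
      _ ≤ N * (N ^ 2 * ‖W‖ * ‖X‖ * ‖Y‖) * ‖Z‖ := by gcongr
      _ = N ^ 3 * M := by rw [hM]; ring
  have s7 : ‖β x Y (Γ (Γ W X) Z)‖ ≤ N ^ 3 * M := by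
    calc ‖β x Y (Γ (Γ W X) Z)‖ ≤ ‖β x‖ * ‖Y‖ * (N ^ 2 * ‖W‖ * ‖X‖ * ‖Z‖) :=
          norm_map₂_le_of_le _ le_rfl (hΓΓ W X Z)
      _ ≤ N * ‖Y‖ * (N ^ 2 * ‖W‖ * ‖X‖ * ‖Z‖) := by gcongr
      _ = N ^ 3 * M := by rw [hM]; ring
  have s8 : ‖fderiv ℝ β x X (Γ W Y) Z‖ ≤ N ^ 3 * M := by
    calc ‖fderiv ℝ β x X (Γ W Y) Z‖ ≤ N * ‖X‖ * (N * ‖W‖ * ‖Y‖) * ‖Z‖ := by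
          refine (norm_map₃_le _ _ _ _).trans ?_; gcongr; exact hΓuv W Y
      _ = N ^ 2 * M := by rw [hM]; ring
      _ ≤ N ^ 3 * M := by gcongr
  have s9 : ‖β x (Γ X (Γ W Y)) Z‖ ≤ N ^ 3 * M := by
    calc ‖β x (Γ X (Γ W Y)) Z‖ ≤ ‖β x‖ * (N ^ 2 * ‖X‖ * ‖W‖ * ‖Y‖) * ‖Z‖ :=
          norm_map₂_le_of_le _ (hΓΓ' X W Y) le_rfl
      _ ≤ N * (N ^ 2 * ‖X‖ * ‖W‖ * ‖Y‖) * ‖Z‖ := by gcongr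
      _ = N ^ 3 * M := by rw [hM]; ring
  have s10 : ‖β x (Γ W Y) (Γ X Z)‖ ≤ N ^ 3 * M := by
    calc ‖β x (Γ W Y) (Γ X Z)‖ ≤ ‖β x‖ * (N * ‖W‖ * ‖Y‖) * (N * ‖X‖ * ‖Z‖) :=
          norm_map₂_le_of_le _ (hΓuv W Y) (hΓuv X Z)
      _ ≤ N * (N * ‖W‖ * ‖Y‖) * (N * ‖X‖ * ‖Z‖) := by gcongr
      _ = N ^ 3 * M := by rw [hM]; ring
  have s11 : ‖fderiv ℝ β x X Y (Γ W Z)‖ ≤ N ^ 3 * M := by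
    calc ‖fderiv ℝ β x X Y (Γ W Z)‖ ≤ N * ‖X‖ * ‖Y‖ * (N * ‖W‖ * ‖Z‖) := by
          refine (norm_map₃_le _ _ _ _).trans ?_; gcongr; exact hΓuv W Z
      _ = N ^ 2 * M := by rw [hM]; ring
      _ ≤ N ^ 3 * M := by gcongr
  have s12 : ‖β x (Γ X Y) (Γ W Z)‖ ≤ N ^ 3 * M := by
    calc ‖β x (Γ X Y) (Γ W Z)‖ ≤ ‖β x‖ * (N * ‖X‖ * ‖Y‖) * (N * ‖W‖ * ‖Z‖) :=
          norm_map₂_le_of_le _ (hΓuv X Y) (hΓuv W Z)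
      _ ≤ N * (N * ‖X‖ * ‖Y‖) * (N * ‖W‖ * ‖Z‖) := by gcongr
      _ = N ^ 3 * M := by rw [hM]; ring
  have s13 : ‖β x Y (Γ X (Γ W Z))‖ ≤ N ^ 3 * M := by
    calc ‖β x Y (Γ X (Γ W Z))‖ ≤ ‖β x‖ * ‖Y‖ * (N ^ 2 * ‖X‖ * ‖W‖ * ‖Z‖) :=
          norm_map₂_le_of_le _ le_rfl (hΓΓ' X W Z)
      _ ≤ N * ‖Y‖ * (N ^ 2 * ‖X‖ * ‖W‖ * ‖Z‖) := by gcongr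
      _ = N ^ 3 * M := by rw [hM]; ring
  have hexp : cov₃At G (cov₂At G β) x W X Y Z =
      fderiv ℝ (fderiv ℝ β) x W X Y Z
      - fderiv ℝ β x W (Γ X Y) Z - β x (DΓ W X Y) Z - fderiv ℝ β x W Y (Γ X Z) - β x Y (DΓ W X Z)
      - fderiv ℝ β x (Γ W X) Y Z + β x (Γ (Γ W X) Y) Z + β x Y (Γ (Γ W X) Z)
      - fderiv ℝ β x X (Γ W Y) Z + β x (Γ X (Γ W Y)) Z + β x (Γ W Y) (Γ X Z)
      - fderiv ℝ β x X Y (Γ W Z) + β x (Γ X Y) (Γ W Z) + β x Y (Γ X (Γ W Z)) := by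
    simp only [cov₃At_apply, hG.fderiv_cov₂At_apply hx hβ, cov₂At_apply]
    ring
  rw [hexp, ← Real.norm_eq_abs]
  have key := norm_add_le_of_le (norm_add_le_of_le (norm_sub_le_of_le (norm_add_le_of_le
    (norm_add_le_of_le (norm_sub_le_of_le (norm_add_le_of_le (norm_add_le_of_le (norm_sub_le_of_le
    (norm_sub_le_of_le (norm_sub_le_of_le (norm_sub_le_of_le (norm_sub_le_of_le
    s0 s1) s2) s3) s4) s5) s6) s7) s8) s9) s10) s11) s12) s13
  calc _ ≤ _ := key
    _ = 14 * N ^ 3 * ‖W‖ * ‖X‖ * ‖Y‖ * ‖Z‖ := by rw [hM]; ring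

end Laplacian

/-! ### The reaction term and its difference -/

section React

variable {ι : Type*} [Fintype ι] [FiniteDimensional ℝ E] [CompleteSpace E] (b : Basis ι ℝ E)
  {G G' : E → E →L[ℝ] E →L[ℝ] ℝ} {V : Set E} {x : E}

/-- The `A`-part of `R − R'`: `riemRem(X,Y)Z = A(X,Γ(Y,Z)) + Γ'(X,A(Y,Z)) − A(Y,Γ(X,Z)) − Γ'(Y,A(X,Z))`.
[cite: Kotschwar2014, §1.1 (8)] -/
def riemRem (G G' : E → E →L[ℝ] E →L[ℝ] ℝ) (x X Y Z : E) : E :=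
  chrDiff G G' x X (chrAt G x Y Z) + chrAt G' x X (chrDiff G G' x Y Z)
    - chrDiff G G' x Y (chrAt G x X Z) - chrAt G' x Y (chrDiff G G' x X Z)

omit [Fintype ι] [FiniteDimensional ℝ E] [CompleteSpace E] in
/-- **`R − R' = (DA(X)(Y) − DA(Y)(X)) + riemRem`** (`DA = DΓ − DΓ'`). [cite: Kotschwar2014, §1.1 (8)] -/
theorem riemAt_sub_eq (X Y Z : E) :
    riemAt G x X Y Z - riemAt G' x X Y Z =
      (fderiv ℝ (chrAt G) x - fderiv ℝ (chrAt G') x) X Y Z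
        - (fderiv ℝ (chrAt G) x - fderiv ℝ (chrAt G') x) Y X Z + riemRem G G' x X Y Z := by
  rw [riemAt_sub_apply]
  simp only [riemRem, chrDiff_apply]
  abel

omit [Fintype ι] [FiniteDimensional ℝ E] [CompleteSpace E] in
/-- `‖riemRem(X,Y)Z‖ ≤ 4 N ‖A‖ ‖X‖‖Y‖‖Z‖` for `‖Γ‖, ‖Γ'‖ ≤ N`. [cite: Kotschwar2014, §1.1 (10)] -/
theorem norm_riemRem_le {N : ℝ} (hΓ : ‖chrAt G x‖ ≤ N) (hΓ' : ‖chrAt G' x‖ ≤ N) (X Y Z : E) :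
    ‖riemRem G G' x X Y Z‖ ≤ 4 * N * ‖chrDiff G G' x‖ * ‖X‖ * ‖Y‖ * ‖Z‖ := by
  set A := chrDiff G G' x
  have hN0 : 0 ≤ N := (norm_nonneg _).trans hΓ
  have hAuv : ∀ u v, ‖A u v‖ ≤ ‖A‖ * ‖u‖ * ‖v‖ := fun u v ↦ le_opNorm₂ A u v
  have hΓuv : ∀ u v, ‖chrAt G x u v‖ ≤ N * ‖u‖ * ‖v‖ := fun u v ↦
    (le_opNorm₂ _ u v).trans (by gcongr)
  have hΓ'uv : ∀ u v, ‖chrAt G' x u v‖ ≤ N * ‖u‖ * ‖v‖ := fun u v ↦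
    (le_opNorm₂ _ u v).trans (by gcongr)
  have t1 : ‖A X (chrAt G x Y Z)‖ ≤ N * ‖A‖ * ‖X‖ * ‖Y‖ * ‖Z‖ :=
    (norm_map₂_le_of_le A le_rfl (hΓuv Y Z)).trans (le_of_eq (by ring))
  have t2 : ‖chrAt G' x X (A Y Z)‖ ≤ N * ‖A‖ * ‖X‖ * ‖Y‖ * ‖Z‖ :=
    (norm_map₂_le_of_le _ le_rfl (hAuv Y Z)).trans (by
      calc ‖chrAt G' x‖ * ‖X‖ * (‖A‖ * ‖Y‖ * ‖Z‖) ≤ N * ‖X‖ * (‖A‖ * ‖Y‖ * ‖Z‖) := by gcongr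
        _ = _ := by ring)
  have t3 : ‖A Y (chrAt G x X Z)‖ ≤ N * ‖A‖ * ‖X‖ * ‖Y‖ * ‖Z‖ :=
    (norm_map₂_le_of_le A le_rfl (hΓuv X Z)).trans (le_of_eq (by ring))
  have t4 : ‖chrAt G' x Y (A X Z)‖ ≤ N * ‖A‖ * ‖X‖ * ‖Y‖ * ‖Z‖ :=
    (norm_map₂_le_of_le _ le_rfl (hAuv X Z)).trans (by
      calc ‖chrAt G' x‖ * ‖Y‖ * (‖A‖ * ‖X‖ * ‖Z‖) ≤ N * ‖Y‖ * (‖A‖ * ‖X‖ * ‖Z‖) := by gcongr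
        _ = _ := by ring)
  calc ‖riemRem G G' x X Y Z‖ ≤ _ := norm_sub_le_of_le (norm_sub_le_of_le (norm_add_le_of_le t1 t2) t3) t4
    _ = 4 * N * ‖A‖ * ‖X‖ * ‖Y‖ * ‖Z‖ := by ring

omit [Fintype ι] [FiniteDimensional ℝ E] [CompleteSpace E] in
/-- **`‖R(X,Y)Z‖ ≤ 4 N² ‖X‖‖Y‖‖Z‖`** for `‖Γ‖, ‖DΓ‖ ≤ N`, `N ≥ 1`. [folklore] -/
theorem norm_riemAt_apply_le {N : ℝ} (hN : 1 ≤ N) (hΓ : ‖chrAt G x‖ ≤ N)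
    (hDΓ : ‖fderiv ℝ (chrAt G) x‖ ≤ N) (X Y Z : E) :
    ‖riemAt G x X Y Z‖ ≤ 4 * N ^ 2 * ‖X‖ * ‖Y‖ * ‖Z‖ := by
  have hN0 : 0 ≤ N := zero_le_one.trans hN
  have hNN : N ≤ N ^ 2 := (pow_one N).symm.trans_le (pow_le_pow_right₀ hN (by norm_num))
  have hΓuv : ∀ u v, ‖chrAt G x u v‖ ≤ N * ‖u‖ * ‖v‖ := fun u v ↦
    (le_opNorm₂ _ u v).trans (by gcongr)
  have t1 : ‖fderiv ℝ (chrAt G) x X Y Z‖ ≤ N ^ 2 * ‖X‖ * ‖Y‖ * ‖Z‖ :=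
    (norm_map₃_le _ X Y Z).trans (by gcongr; exact hDΓ.trans hNN)
  have t2 : ‖fderiv ℝ (chrAt G) x Y X Z‖ ≤ N ^ 2 * ‖X‖ * ‖Y‖ * ‖Z‖ :=
    (norm_map₃_le _ Y X Z).trans (by
      calc ‖fderiv ℝ (chrAt G) x‖ * ‖Y‖ * ‖X‖ * ‖Z‖ ≤ N ^ 2 * ‖Y‖ * ‖X‖ * ‖Z‖ := by
            gcongr; exact hDΓ.trans hNN
        _ = _ := by ring)
  have t3 : ‖chrAt G x X (chrAt G x Y Z)‖ ≤ N ^ 2 * ‖X‖ * ‖Y‖ * ‖Z‖ :=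
    (norm_map₂_le_of_le _ le_rfl (hΓuv Y Z)).trans (by
      calc ‖chrAt G x‖ * ‖X‖ * (N * ‖Y‖ * ‖Z‖) ≤ N * ‖X‖ * (N * ‖Y‖ * ‖Z‖) := by gcongr
        _ = _ := by ring)
  have t4 : ‖chrAt G x Y (chrAt G x X Z)‖ ≤ N ^ 2 * ‖X‖ * ‖Y‖ * ‖Z‖ :=
    (norm_map₂_le_of_le _ le_rfl (hΓuv X Z)).trans (by
      calc ‖chrAt G x‖ * ‖Y‖ * (N * ‖X‖ * ‖Z‖) ≤ N * ‖Y‖ * (N * ‖X‖ * ‖Z‖) := by gcongr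
        _ = _ := by ring)
  rw [riemAt_apply]
  calc _ ≤ _ := norm_sub_le_of_le (norm_add_le_of_le (norm_sub_le_of_le t1 t2) t3) t4
    _ = 4 * N ^ 2 * ‖X‖ * ‖Y‖ * ‖Z‖ := by ring

/-- One term of the reaction sum:
`reactTerm G x W U Y Z = Ric(R(W,Y)Z, U) + Ric(R(W,Z)Y, U) + Ric(Z, R(W,Y)U) + Ric(Y, R(W,Z)U)`
(with `W = bᵢ`, `U = bⱼ`). [cite: Hamilton1982, Cor. 7.3] -/
def reactTerm (G : E → E →L[ℝ] E →L[ℝ] ℝ) (x W U Y Z : E) : ℝ :=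
  ricAt G x (riemAt G x W Y Z) U + ricAt G x (riemAt G x W Z Y) U
    + ricAt G x Z (riemAt G x W Y U) + ricAt G x Y (riemAt G x W Z U)

/-- **The reaction term** of the evolution of the Ricci tensor (symmetrized form):
`Σ_{ij} g^{ij} reactTerm G x bᵢ bⱼ Y Z` (`CoordRicciEvolution.hasDerivWithinAt_ricAt_ricciFlow`).
[cite: Hamilton1982, Cor. 7.3] -/
def ricReactAt (G : E → E →L[ℝ] E →L[ℝ] ℝ) (x Y Z : E) : ℝ :=
  ∑ i, ∑ j, ginv G b x i j * reactTerm G x (b i) (b j) Y Z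

/-- **The right-hand side of the evolution of the Ricci tensor under the Ricci flow**,
`ΔRic(Y,Z) + (reaction)` (Hamilton 1982, Cor. 7.3, in the symmetrized form of
`CoordRicciEvolution.hasDerivWithinAt_ricAt_ricciFlow`). [cite: Hamilton1982, Cor. 7.3] -/
def ricEvolAt (G : E → E →L[ℝ] E →L[ℝ] ℝ) (x Y Z : E) : ℝ :=
  lapBilinAt G (ricAt G) x Y Z + ricReactAt b G x Y Z

/-- The `DA`-part of the difference of reaction terms (goes into the divergence `div U`).
[cite: Kotschwar2014, §1.1 (8)] -/
def reactDA (G G' : E → E →L[ℝ] E →L[ℝ] ℝ) (x W U Y Z : E) : ℝ :=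
  ricAt G' x ((fderiv ℝ (chrAt G) x - fderiv ℝ (chrAt G') x) W Y Z
      - (fderiv ℝ (chrAt G) x - fderiv ℝ (chrAt G') x) Y W Z) U
  + ricAt G' x ((fderiv ℝ (chrAt G) x - fderiv ℝ (chrAt G') x) W Z Y
      - (fderiv ℝ (chrAt G) x - fderiv ℝ (chrAt G') x) Z W Y) U
  + ricAt G' x Z ((fderiv ℝ (chrAt G) x - fderiv ℝ (chrAt G') x) W Y U
      - (fderiv ℝ (chrAt G) x - fderiv ℝ (chrAt G') x) Y W U)
  + ricAt G' x Y ((fderiv ℝ (chrAt G) x - fderiv ℝ (chrAt G') x) W Z U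
      - (fderiv ℝ (chrAt G) x - fderiv ℝ (chrAt G') x) Z W U)

/-- The `P`- and `A`-part of the difference of reaction terms. [cite: Kotschwar2014, §1.1 (8)] -/
def reactPRem (G G' : E → E →L[ℝ] E →L[ℝ] ℝ) (x W U Y Z : E) : ℝ :=
  ricDiff G G' x (riemAt G x W Y Z) U + ricDiff G G' x (riemAt G x W Z Y) U
    + ricDiff G G' x Z (riemAt G x W Y U) + ricDiff G G' x Y (riemAt G x W Z U)
    + ricAt G' x (riemRem G G' x W Y Z) U + ricAt G' x (riemRem G G' x W Z Y) U
    + ricAt G' x Z (riemRem G G' x W Y U) + ricAt G' x Y (riemRem G G' x W Z U)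

omit [Fintype ι] [CompleteSpace E] in
/-- **Difference of reaction terms**: `reactTerm G − reactTerm G' = reactDA + reactPRem`.
[cite: Kotschwar2014, §1.1 (8)] -/
theorem reactTerm_sub (W U Y Z : E) :
    reactTerm G x W U Y Z - reactTerm G' x W U Y Z = reactDA G G' x W U Y Z + reactPRem G G' x W U Y Z := by
  have hR : ∀ X Y Z, riemAt G' x X Y Z = riemAt G x X Y Z
      - ((fderiv ℝ (chrAt G) x - fderiv ℝ (chrAt G') x) X Y Z
        - (fderiv ℝ (chrAt G) x - fderiv ℝ (chrAt G') x) Y X Z + riemRem G G' x X Y Z) := by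
    intro X Y Z
    rw [← riemAt_sub_eq]
    abel
  have hRic : ricAt G' x = ricAt G x - ricDiff G G' x := by
    simp only [ricDiff_apply, sub_sub_cancel]
  simp only [reactTerm, reactDA, reactPRem, hR]
  rw [hRic]
  simp only [ricDiff_apply, map_sub, map_add, _root_.sub_apply, _root_.add_apply]
  ring

omit [Fintype ι] [CompleteSpace E] in
/-- `|reactTerm G x W U Y Z| ≤ 16 N³ ‖W‖‖U‖‖Y‖‖Z‖` for `‖Ric‖, ‖Γ‖, ‖DΓ‖ ≤ N`, `N ≥ 1`.
[folklore] -/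
theorem abs_reactTerm_le {N : ℝ} (hN : 1 ≤ N) (hRic : ‖ricAt G x‖ ≤ N) (hΓ : ‖chrAt G x‖ ≤ N)
    (hDΓ : ‖fderiv ℝ (chrAt G) x‖ ≤ N) (W U Y Z : E) :
    |reactTerm G x W U Y Z| ≤ 16 * N ^ 3 * ‖W‖ * ‖U‖ * ‖Y‖ * ‖Z‖ := by
  have hN0 : 0 ≤ N := zero_le_one.trans hN
  have hR := norm_riemAt_apply_le (G := G) (x := x) hN hΓ hDΓ
  have t1 : ‖ricAt G x (riemAt G x W Y Z) U‖ ≤ N * (4 * N ^ 2 * ‖W‖ * ‖Y‖ * ‖Z‖) * ‖U‖ :=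
    (norm_map₂_le_of_le _ (hR W Y Z) le_rfl).trans (by gcongr)
  have t2 : ‖ricAt G x (riemAt G x W Z Y) U‖ ≤ N * (4 * N ^ 2 * ‖W‖ * ‖Z‖ * ‖Y‖) * ‖U‖ :=
    (norm_map₂_le_of_le _ (hR W Z Y) le_rfl).trans (by gcongr)
  have t3 : ‖ricAt G x Z (riemAt G x W Y U)‖ ≤ N * ‖Z‖ * (4 * N ^ 2 * ‖W‖ * ‖Y‖ * ‖U‖) :=
    (norm_map₂_le_of_le _ le_rfl (hR W Y U)).trans (by gcongr)
  have t4 : ‖ricAt G x Y (riemAt G x W Z U)‖ ≤ N * ‖Y‖ * (4 * N ^ 2 * ‖W‖ * ‖Z‖ * ‖U‖) :=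
    (norm_map₂_le_of_le _ le_rfl (hR W Z U)).trans (by gcongr)
  rw [← Real.norm_eq_abs, reactTerm]
  calc _ ≤ _ := norm_add_le_of_le (norm_add_le_of_le (norm_add_le_of_le t1 t2) t3) t4
    _ = 16 * N ^ 3 * ‖W‖ * ‖U‖ * ‖Y‖ * ‖Z‖ := by ring

omit [Fintype ι] [CompleteSpace E] in
/-- `|reactPRem| ≤ 16 N² (‖P‖ + ‖A‖) ‖W‖‖U‖‖Y‖‖Z‖` for `‖Ric'‖, ‖Γ‖, ‖Γ'‖, ‖DΓ‖ ≤ N`, `N ≥ 1`.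
[cite: Kotschwar2014, §1.1 (10)] -/
theorem abs_reactPRem_le {N : ℝ} (hN : 1 ≤ N) (hRic' : ‖ricAt G' x‖ ≤ N) (hΓ : ‖chrAt G x‖ ≤ N)
    (hΓ' : ‖chrAt G' x‖ ≤ N) (hDΓ : ‖fderiv ℝ (chrAt G) x‖ ≤ N) (W U Y Z : E) :
    |reactPRem G G' x W U Y Z| ≤
      16 * N ^ 2 * (‖ricDiff G G' x‖ + ‖chrDiff G G' x‖) * ‖W‖ * ‖U‖ * ‖Y‖ * ‖Z‖ := by
  set P := ricDiff G G' x
  set A := chrDiff G G' x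
  have hN0 : 0 ≤ N := zero_le_one.trans hN
  have hR := norm_riemAt_apply_le (G := G) (x := x) hN hΓ hDΓ
  have hRR := norm_riemRem_le (G := G) (G' := G') (x := x) hΓ hΓ'
  have t1 : ‖P (riemAt G x W Y Z) U‖ ≤ ‖P‖ * (4 * N ^ 2 * ‖W‖ * ‖Y‖ * ‖Z‖) * ‖U‖ :=
    norm_map₂_le_of_le _ (hR W Y Z) le_rfl
  have t2 : ‖P (riemAt G x W Z Y) U‖ ≤ ‖P‖ * (4 * N ^ 2 * ‖W‖ * ‖Z‖ * ‖Y‖) * ‖U‖ :=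
    norm_map₂_le_of_le _ (hR W Z Y) le_rfl
  have t3 : ‖P Z (riemAt G x W Y U)‖ ≤ ‖P‖ * ‖Z‖ * (4 * N ^ 2 * ‖W‖ * ‖Y‖ * ‖U‖) :=
    norm_map₂_le_of_le _ le_rfl (hR W Y U)
  have t4 : ‖P Y (riemAt G x W Z U)‖ ≤ ‖P‖ * ‖Y‖ * (4 * N ^ 2 * ‖W‖ * ‖Z‖ * ‖U‖) :=
    norm_map₂_le_of_le _ le_rfl (hR W Z U)
  have t5 : ‖ricAt G' x (riemRem G G' x W Y Z) U‖ ≤ N * (4 * N * ‖A‖ * ‖W‖ * ‖Y‖ * ‖Z‖) * ‖U‖ :=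
    (norm_map₂_le_of_le _ (hRR W Y Z) le_rfl).trans (by gcongr)
  have t6 : ‖ricAt G' x (riemRem G G' x W Z Y) U‖ ≤ N * (4 * N * ‖A‖ * ‖W‖ * ‖Z‖ * ‖Y‖) * ‖U‖ :=
    (norm_map₂_le_of_le _ (hRR W Z Y) le_rfl).trans (by gcongr)
  have t7 : ‖ricAt G' x Z (riemRem G G' x W Y U)‖ ≤ N * ‖Z‖ * (4 * N * ‖A‖ * ‖W‖ * ‖Y‖ * ‖U‖) :=
    (norm_map₂_le_of_le _ le_rfl (hRR W Y U)).trans (by gcongr)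
  have t8 : ‖ricAt G' x Y (riemRem G G' x W Z U)‖ ≤ N * ‖Y‖ * (4 * N * ‖A‖ * ‖W‖ * ‖Z‖ * ‖U‖) :=
    (norm_map₂_le_of_le _ le_rfl (hRR W Z U)).trans (by gcongr)
  rw [← Real.norm_eq_abs, reactPRem]
  calc _ ≤ _ := norm_add_le_of_le (norm_add_le_of_le (norm_add_le_of_le (norm_add_le_of_le
      (norm_add_le_of_le (norm_add_le_of_le (norm_add_le_of_le t1 t2) t3) t4) t5) t6) t7) t8
    _ = 16 * N ^ 2 * (‖P‖ + ‖A‖) * ‖W‖ * ‖U‖ * ‖Y‖ * ‖Z‖ := by ring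

end React

/-! ### The evolution difference: principal part, divergence part and remainder -/

section Assembly

variable {ι : Type*} [Fintype ι] [FiniteDimensional ℝ E] [CompleteSpace E] (b : Basis ι ℝ E)
  {G G' : E → E →L[ℝ] E →L[ℝ] ℝ} {V : Set E} {x : E}

/-- The **raw divergence part** of `Λ(G) − Λ(G')`: all the terms containing `DA = DΓ − DΓ'`
(linearly); it is brought to divergence form `Σₖ ∂ₖ Uᵏ` downstream. [cite: Kotschwar2014, §1.1 (8)] -/
def divRaw (G G' : E → E →L[ℝ] E →L[ℝ] ℝ) (x Y Z : E) : ℝ :=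
  ∑ i, ∑ j, ginv G' b x i j *
    (-(ricAt G' x ((fderiv ℝ (chrAt G) x - fderiv ℝ (chrAt G') x) (b i) (b j) Y) Z)
      - ricAt G' x Y ((fderiv ℝ (chrAt G) x - fderiv ℝ (chrAt G') x) (b i) (b j) Z)
      + reactDA G G' x (b i) (b j) Y Z)

/-- The **remainder** of `Λ(G) − Λ(G')`: all the terms controlled pointwise by `H, A, P, dP`.
[cite: Kotschwar2014, §1.1 (8)–(10)] -/
def fRaw (G G' : E → E →L[ℝ] E →L[ℝ] ℝ) (x Y Z : E) : ℝ :=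
  ∑ i, ∑ j, (ginv G b x i j * lapPRem G G' x (b i) (b j) Y Z
    + (ginv G b x i j - ginv G' b x i j) * cov₃At G (cov₂At G (ricAt G')) x (b i) (b j) Y Z
    + ginv G' b x i j * cov₃cov₂Rem G G' (ricAt G') x (b i) (b j) Y Z
    + (ginv G b x i j - ginv G' b x i j) * reactTerm G x (b i) (b j) Y Z
    + ginv G' b x i j * reactPRem G G' x (b i) (b j) Y Z)

/-- **The difference of the evolution right-hand sides** (Kotschwar 2014, §1.1, (8): "every term
contains either a factor of one of the group or `∇S`", here with `S` the Ricci difference `P`):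
`Λ(G) − Λ(G') = Σ g^{ij} D²P(bᵢ,bⱼ;Y,Z) + divRaw + fRaw`. [cite: Kotschwar2014, §1.1 (8)] -/
theorem IsMetricOn.ricEvolAt_sub (hG : IsMetricOn G V) (hG' : IsMetricOn G' V) (hx : x ∈ V) (Y Z : E) :
    ricEvolAt b G x Y Z - ricEvolAt b G' x Y Z =
      (∑ i, ∑ j, ginv G b x i j * fderiv ℝ (fderiv ℝ (ricDiff G G')) x (b i) (b j) Y Z)
        + divRaw b G G' x Y Z + fRaw b G G' x Y Z := by
  have hβ : ContDiffAt ℝ ∞ (ricAt G') x := hG'.contDiffAt_ricAt hx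
  have hlin : ∀ i j, cov₃At G (cov₂At G (ricAt G)) x (b i) (b j) Y Z
      - cov₃At G (cov₂At G (ricAt G')) x (b i) (b j) Y Z
      = cov₃At G (cov₂At G (ricDiff G G')) x (b i) (b j) Y Z := by
    intro i j
    have h := congrArg (fun T : E →L[ℝ] E →L[ℝ] E →L[ℝ] E →L[ℝ] ℝ ↦ T (b i) (b j) Y Z)
      (hG.cov₃At_cov₂At_field_sub hx hG.contDiffOn_ricAt hG'.contDiffOn_ricAt)
    simp only [_root_.sub_apply] at h
    exact h.symm
  have hP := fun i j ↦ hG.cov₃At_cov₂At_ricDiff hG' hx (b i) (b j) Y Z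
  have hS := fun i j ↦ hG.cov₃At_cov₂At_sub hG' hx hβ (b i) (b j) Y Z
  have hT := fun i j ↦ reactTerm_sub (G := G) (G' := G') (x := x) (b i) (b j) Y Z
  -- everything is a double sum over `i, j`
  simp only [ricEvolAt, ricReactAt, lapBilinAt_apply_eq_sum _ _ b, divRaw, fRaw,
    ← Finset.sum_add_distrib, ← Finset.sum_sub_distrib]
  refine Finset.sum_congr rfl fun i _ ↦ Finset.sum_congr rfl fun j _ ↦ ?_
  have h1 := hlin i j
  have h2 := hP i j
  have h3 := hS i j
  have h4 := hT i j
  -- `g cc − g' cc' = g (cc − cc~) + (g − g') cc~ + g' (cc~ − cc')`, and similarly for the reaction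
  linear_combination (ginv G b x i j) * h1 + (ginv G b x i j) * h2 + (ginv G' b x i j) * h3
    + (ginv G' b x i j) * h4

/-! #### Bookkeeping of the background bounds -/

/-- **A common bound `N ≥ 1` for the background quantities of the pair `(G, G')` at `x`** (the
metrics, their first derivatives, `♯`, `Γ`, `DΓ`, `Ric`, `DRic`, `D²Ric'`, and the basis with
its dual basis). On a compact set all these are bounded by continuity; this structure only
packages the hypotheses of the pointwise estimates. [folklore] -/
structure PairBound (G G' : E → E →L[ℝ] E →L[ℝ] ℝ) (x : E) (N : ℝ) : Prop where
  one_le : 1 ≤ N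
  metric : ‖G x‖ ≤ N
  metric' : ‖G' x‖ ≤ N
  dmetric : ‖fderiv ℝ G x‖ ≤ N
  dmetric' : ‖fderiv ℝ G' x‖ ≤ N
  sharp : ‖sharpAt G x‖ ≤ N
  sharp' : ‖sharpAt G' x‖ ≤ N
  chr : ‖chrAt G x‖ ≤ N
  chr' : ‖chrAt G' x‖ ≤ N
  dchr : ‖fderiv ℝ (chrAt G) x‖ ≤ N
  dchr' : ‖fderiv ℝ (chrAt G') x‖ ≤ N
  ric : ‖ricAt G x‖ ≤ N
  ric' : ‖ricAt G' x‖ ≤ N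
  dric : ‖fderiv ℝ (ricAt G) x‖ ≤ N
  dric' : ‖fderiv ℝ (ricAt G') x‖ ≤ N
  ddric' : ‖fderiv ℝ (fderiv ℝ (ricAt G')) x‖ ≤ N
  basis : ∀ i, ‖b i‖ ≤ N
  coord : ∀ i, ‖coordCLM b i‖ ≤ N

namespace PairBound

variable {b} {N : ℝ} (hN : PairBound b G G' x N)
include hN

omit [Fintype ι] [CompleteSpace E] in
/-- `0 ≤ N`. [folklore] -/
theorem nonneg : 0 ≤ N := zero_le_one.trans hN.one_le

omit [Fintype ι] [CompleteSpace E] in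
/-- `N ≤ N^k` for `k ≥ 1`. [folklore] -/
theorem le_pow {k : ℕ} (hk : 1 ≤ k) : N ≤ N ^ k :=
  (pow_one N).symm.trans_le (pow_le_pow_right₀ hN.one_le hk)

omit [Fintype ι] [CompleteSpace E] in
/-- `N^j ≤ N^k` for `j ≤ k`. [folklore] -/
theorem pow_le_pow {j k : ℕ} (hjk : j ≤ k) : N ^ j ≤ N ^ k := pow_le_pow_right₀ hN.one_le hjk

omit [Fintype ι] [CompleteSpace E] in
/-- `|g^{ij}| ≤ N³`. [folklore] -/
theorem abs_ginv_le (i j : ι) : |ginv G b x i j| ≤ N ^ 3 := by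
  rw [ginv, ← coordCLM_apply, ← Real.norm_eq_abs]
  calc ‖coordCLM b i (sharpAt G x (coordCLM b j))‖ ≤ ‖coordCLM b i‖ * (‖sharpAt G x‖ * ‖coordCLM b j‖) :=
        (le_opNorm _ _).trans (by gcongr; exact le_opNorm _ _)
    _ ≤ N * (N * N) := by
        have := hN.nonneg
        gcongr
        exacts [hN.coord i, hN.sharp, hN.coord j]
    _ = N ^ 3 := by ring

omit [Fintype ι] [CompleteSpace E] in
/-- `|g'^{ij}| ≤ N³`. [folklore] -/
theorem abs_ginv'_le (i j : ι) : |ginv G' b x i j| ≤ N ^ 3 := by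
  rw [ginv, ← coordCLM_apply, ← Real.norm_eq_abs]
  calc ‖coordCLM b i (sharpAt G' x (coordCLM b j))‖ ≤ ‖coordCLM b i‖ * (‖sharpAt G' x‖ * ‖coordCLM b j‖) :=
        (le_opNorm _ _).trans (by gcongr; exact le_opNorm _ _)
    _ ≤ N * (N * N) := by
        have := hN.nonneg
        gcongr
        exacts [hN.coord i, hN.sharp', hN.coord j]
    _ = N ^ 3 := by ring

omit [Fintype ι] [CompleteSpace E] in
/-- `|g^{ij} − g'^{ij}| ≤ N⁴ ‖H‖`. [cite: Kotschwar2014, §1.1 (5)] -/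
theorem abs_ginv_sub_le (hi : (G x).IsInvertible) (hi' : (G' x).IsInvertible) (i j : ι) :
    |ginv G b x i j - ginv G' b x i j| ≤ N ^ 4 * ‖G x - G' x‖ := by
  have h0 := hN.nonneg
  calc |ginv G b x i j - ginv G' b x i j|
      ≤ ‖coordCLM b i‖ * (‖sharpAt G x‖ * ‖G x - G' x‖ * ‖sharpAt G' x‖) * ‖coordCLM b j‖ :=
        MetricCoord.abs_ginv_sub_le b hi hi' i j
    _ ≤ N * (N * ‖G x - G' x‖ * N) * N := by
        gcongr
        exacts [hN.coord i, hN.sharp, hN.sharp', hN.coord j]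
    _ = N ^ 4 * ‖G x - G' x‖ := by ring

omit [Fintype ι] [CompleteSpace E] in
/-- `‖∇Ric‖ ≤ 3 N²`. [folklore] -/
theorem norm_cov₂At_ricAt_le : ‖cov₂At G (ricAt G) x‖ ≤ 3 * N ^ 2 := by
  have h0 := hN.nonneg
  have hNN : N ≤ N ^ 2 := hN.le_pow (by norm_num)
  refine ContinuousLinearMap.opNorm_le_bound _ (by positivity) fun W ↦ ?_
  refine ContinuousLinearMap.opNorm_le_bound _ (by positivity) fun Y ↦ ?_
  refine ContinuousLinearMap.opNorm_le_bound _ (by positivity) fun Z ↦ ?_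
  rw [cov₂At_apply]
  have t1 : ‖fderiv ℝ (ricAt G) x W Y Z‖ ≤ N * ‖W‖ * ‖Y‖ * ‖Z‖ :=
    (norm_map₃_le _ W Y Z).trans (by gcongr; exact hN.dric)
  have hΓ : ∀ u v, ‖chrAt G x u v‖ ≤ N * ‖u‖ * ‖v‖ := fun u v ↦
    (le_opNorm₂ _ u v).trans (by gcongr; exact hN.chr)
  have t2 : ‖ricAt G x (chrAt G x W Y) Z‖ ≤ N * (N * ‖W‖ * ‖Y‖) * ‖Z‖ :=
    (norm_map₂_le_of_le _ (hΓ W Y) le_rfl).trans (by gcongr; exact hN.ric)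
  have t3 : ‖ricAt G x Y (chrAt G x W Z)‖ ≤ N * ‖Y‖ * (N * ‖W‖ * ‖Z‖) :=
    (norm_map₂_le_of_le _ le_rfl (hΓ W Z)).trans (by gcongr; exact hN.ric)
  calc _ ≤ _ := norm_sub_le_of_le (norm_sub_le_of_le t1 t2) t3
    _ = (N + 2 * N ^ 2) * ‖W‖ * ‖Y‖ * ‖Z‖ := by ring
    _ ≤ 3 * N ^ 2 * ‖W‖ * ‖Y‖ * ‖Z‖ := by gcongr; linarith

end PairBound

omit [Fintype ι] [CompleteSpace E] in
/-- **The bound on `∂_t A`** packaged: `‖(Π − Π')(X,Y)‖ ≤ 27 N⁵ (‖H‖ + ‖A‖ + ‖P‖ + ‖dP‖) ‖X‖‖Y‖`.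
[cite: Kotschwar2014, §1.1 (9)] -/
theorem PairBound.norm_piFlowAt_sub_le {N : ℝ} (hN : PairBound b G G' x N) (hi : (G x).IsInvertible)
    (hi' : (G' x).IsInvertible) (X Y : E) :
    ‖piFlowAt G x X Y - piFlowAt G' x X Y‖ ≤
      27 * N ^ 5 * (‖G x - G' x‖ + ‖chrAt G x - chrAt G' x‖ + ‖ricAt G x - ricAt G' x‖
        + ‖fderiv ℝ (ricAt G) x - fderiv ℝ (ricAt G') x‖) * ‖X‖ * ‖Y‖ := by
  have h0 := hN.nonneg
  have h1 := hN.one_le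
  set H := ‖G x - G' x‖
  set A := ‖chrAt G x - chrAt G' x‖
  set P := ‖ricAt G x - ricAt G' x‖
  set dP := ‖fderiv ℝ (ricAt G) x - fderiv ℝ (ricAt G') x‖
  have hC := hN.norm_cov₂At_ricAt_le
  have key := norm_piFlowAt_sub_apply_le (G := G) (G' := G') hi hi' X Y
  have hN2 : N ^ 2 ≤ N ^ 5 := hN.pow_le_pow (by norm_num)
  have hN4 : N ^ 4 ≤ N ^ 5 := hN.pow_le_pow (by norm_num)
  have hN1 : N ≤ N ^ 5 := hN.le_pow (by norm_num)
  have hb1 : 3 * ‖sharpAt G x‖ * ‖sharpAt G' x‖ * ‖cov₂At G (ricAt G) x‖ * H ≤ 9 * N ^ 4 * H := by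
    calc 3 * ‖sharpAt G x‖ * ‖sharpAt G' x‖ * ‖cov₂At G (ricAt G) x‖ * H
        ≤ 3 * N * N * (3 * N ^ 2) * H := by gcongr; exacts [hN.sharp, hN.sharp']
      _ = 9 * N ^ 4 * H := by ring
  have hb2 : 3 * ‖sharpAt G' x‖ * (dP + 2 * ‖ricAt G x‖ * A + 2 * ‖chrAt G' x‖ * P)
      ≤ 3 * N * (dP + 2 * N * A + 2 * N * P) := by
    gcongr; exacts [hN.sharp', hN.ric, hN.chr']
  have hXY : 0 ≤ ‖X‖ * ‖Y‖ := by positivity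
  have hA : 0 ≤ A := norm_nonneg _
  have hP : 0 ≤ P := norm_nonneg _
  have hdP : 0 ≤ dP := norm_nonneg _
  have hH : 0 ≤ H := norm_nonneg _
  have hB : 3 * ‖sharpAt G x‖ * ‖sharpAt G' x‖ * ‖cov₂At G (ricAt G) x‖ * H
      + 3 * ‖sharpAt G' x‖ * (dP + 2 * ‖ricAt G x‖ * A + 2 * ‖chrAt G' x‖ * P)
      ≤ 27 * N ^ 5 * (H + A + P + dP) := by
    nlinarith [hb1, hb2, mul_le_mul_of_nonneg_right hN4 hH, mul_le_mul_of_nonneg_right hN1 hdP,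
      mul_le_mul_of_nonneg_right hN2 hA, mul_le_mul_of_nonneg_right hN2 hP,
      mul_nonneg (pow_nonneg h0 5) hH, mul_nonneg (pow_nonneg h0 5) hA,
      mul_nonneg (pow_nonneg h0 5) hP, mul_nonneg (pow_nonneg h0 5) hdP]
  calc ‖piFlowAt G x X Y - piFlowAt G' x X Y‖ ≤ _ := key
    _ = (3 * ‖sharpAt G x‖ * ‖sharpAt G' x‖ * ‖cov₂At G (ricAt G) x‖ * H
      + 3 * ‖sharpAt G' x‖ * (dP + 2 * ‖ricAt G x‖ * A + 2 * ‖chrAt G' x‖ * P)) * (‖X‖ * ‖Y‖) := by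
        ring
    _ ≤ (27 * N ^ 5 * (H + A + P + dP)) * (‖X‖ * ‖Y‖) := mul_le_mul_of_nonneg_right hB hXY
    _ = _ := by ring
set_option maxHeartbeats 400000 in -- buildfix (bf3-g31): 160k/180k FAIL, 200k PASS at accept time; line-neutral budget line
/-- **The bound on the remainder `fRaw`**:
`|fRaw| ≤ 76 n² N⁹ (‖H‖ + ‖A‖ + ‖P‖ + ‖dP‖) ‖Y‖‖Z‖` (`n = dim E`). [cite: Kotschwar2014, §1.1 (10)] -/
theorem PairBound.abs_fRaw_le {N : ℝ} (hN : PairBound b G G' x N) (hG : IsMetricOn G V)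
    (hG' : IsMetricOn G' V) (hx : x ∈ V) (Y Z : E) :
    |fRaw b G G' x Y Z| ≤ 76 * (Fintype.card ι : ℝ) ^ 2 * N ^ 9 *
      (‖G x - G' x‖ + ‖chrDiff G G' x‖ + ‖ricDiff G G' x‖ + ‖fderiv ℝ (ricDiff G G') x‖)
      * ‖Y‖ * ‖Z‖ := by
  have h0 := hN.nonneg
  have h1 := hN.one_le
  have hi := hG.isInvertible x hx
  have hi' := hG'.isInvertible x hx
  set H := ‖G x - G' x‖ with hH
  set A := ‖chrDiff G G' x‖ with hA
  set P := ‖ricDiff G G' x‖ with hP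
  set dP := ‖fderiv ℝ (ricDiff G G') x‖ with hdP
  set D := H + A + P + dP with hD
  have hH0 : 0 ≤ H := norm_nonneg _
  have hA0 : 0 ≤ A := norm_nonneg _
  have hP0 : 0 ≤ P := norm_nonneg _
  have hdP0 : 0 ≤ dP := norm_nonneg _
  have hD0 : 0 ≤ D := by positivity
  have hHD : H ≤ D := by rw [hD]; linarith
  have hAD : A ≤ D := by rw [hD]; linarith
  have hPD : P + dP ≤ D := by rw [hD]; linarith
  have hPA : P + A ≤ D := by rw [hD]; linarith
  have hYZ : 0 ≤ ‖Y‖ * ‖Z‖ := by positivity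
  have hbi : ∀ i, ‖b i‖ ≤ N := hN.basis
  -- the five summands, for each `i, j`, are `≤ c N⁹ D ‖Y‖‖Z‖`
  have hchrA : ‖chrAt G x - chrAt G' x‖ = A := rfl
  have key : ∀ i j, |ginv G b x i j * lapPRem G G' x (b i) (b j) Y Z
      + (ginv G b x i j - ginv G' b x i j) * cov₃At G (cov₂At G (ricAt G')) x (b i) (b j) Y Z
      + ginv G' b x i j * cov₃cov₂Rem G G' (ricAt G') x (b i) (b j) Y Z
      + (ginv G b x i j - ginv G' b x i j) * reactTerm G x (b i) (b j) Y Z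
      + ginv G' b x i j * reactPRem G G' x (b i) (b j) Y Z| ≤ 76 * N ^ 9 * D * (‖Y‖ * ‖Z‖) := by
    intro i j
    have g1 := hN.abs_ginv_le i j
    have g2 := hN.abs_ginv'_le i j
    have g3 := hN.abs_ginv_sub_le hi hi' i j
    have r1 := abs_lapPRem_le (G := G) (G' := G') (x := x) h1 hN.chr hN.dchr (b i) (b j) Y Z
    have r2 := hG.abs_cov₃At_cov₂At_le hx (hG'.contDiffAt_ricAt hx) h1 hN.ric' hN.dric' hN.ddric'
      hN.chr hN.dchr (b i) (b j) Y Z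
    have r3 := abs_cov₃cov₂Rem_le (G := G) (G' := G') (x := x) (β := ricAt G') h1 hN.ric' hN.dric'
      hN.chr hN.chr' (b i) (b j) Y Z
    have r4 := abs_reactTerm_le (G := G) (x := x) h1 hN.ric hN.chr hN.dchr (b i) (b j) Y Z
    have r5 := abs_reactPRem_le (G := G) (G' := G') (x := x) h1 hN.ric' hN.chr hN.chr' hN.dchr
      (b i) (b j) Y Z
    rw [hchrA] at r3
    have hbij : ‖b i‖ * ‖b j‖ ≤ N ^ 2 := by
      calc ‖b i‖ * ‖b j‖ ≤ N * N := by gcongr; exacts [hbi i, hbi j]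
        _ = N ^ 2 := by ring
    have hb0 : 0 ≤ ‖b i‖ * ‖b j‖ := by positivity
    -- each product
    have p1 : |ginv G b x i j * lapPRem G G' x (b i) (b j) Y Z| ≤ 13 * N ^ 9 * D * (‖Y‖ * ‖Z‖) := by
      rw [abs_mul]
      calc |ginv G b x i j| * |lapPRem G G' x (b i) (b j) Y Z|
          ≤ N ^ 3 * (13 * N ^ 2 * (P + dP) * ‖b i‖ * ‖b j‖ * ‖Y‖ * ‖Z‖) :=
            mul_le_mul g1 r1 (abs_nonneg _) (by positivity)
        _ = 13 * (N ^ 5 * (‖b i‖ * ‖b j‖)) * (P + dP) * (‖Y‖ * ‖Z‖) := by ring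
        _ ≤ 13 * (N ^ 5 * N ^ 2) * D * (‖Y‖ * ‖Z‖) := by gcongr
        _ = 13 * N ^ 7 * D * (‖Y‖ * ‖Z‖) := by ring
        _ ≤ 13 * N ^ 9 * D * (‖Y‖ * ‖Z‖) := by
            have h79 : N ^ 7 ≤ N ^ 9 := hN.pow_le_pow (by norm_num)
            gcongr
    have p2 : |(ginv G b x i j - ginv G' b x i j) * cov₃At G (cov₂At G (ricAt G')) x (b i) (b j) Y Z|
        ≤ 14 * N ^ 9 * D * (‖Y‖ * ‖Z‖) := by
      rw [abs_mul]
      calc |ginv G b x i j - ginv G' b x i j| * |cov₃At G (cov₂At G (ricAt G')) x (b i) (b j) Y Z|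
          ≤ (N ^ 4 * H) * (14 * N ^ 3 * ‖b i‖ * ‖b j‖ * ‖Y‖ * ‖Z‖) :=
            mul_le_mul g3 r2 (abs_nonneg _) (by positivity)
        _ = 14 * (N ^ 7 * (‖b i‖ * ‖b j‖)) * H * (‖Y‖ * ‖Z‖) := by ring
        _ ≤ 14 * (N ^ 7 * N ^ 2) * D * (‖Y‖ * ‖Z‖) := by gcongr
        _ = 14 * N ^ 9 * D * (‖Y‖ * ‖Z‖) := by ring
    have p3 : |ginv G' b x i j * cov₃cov₂Rem G G' (ricAt G') x (b i) (b j) Y Z|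
        ≤ 17 * N ^ 9 * D * (‖Y‖ * ‖Z‖) := by
      rw [abs_mul]
      calc |ginv G' b x i j| * |cov₃cov₂Rem G G' (ricAt G') x (b i) (b j) Y Z|
          ≤ N ^ 3 * (17 * N ^ 2 * A * ‖b i‖ * ‖b j‖ * ‖Y‖ * ‖Z‖) :=
            mul_le_mul g2 r3 (abs_nonneg _) (by positivity)
        _ = 17 * (N ^ 5 * (‖b i‖ * ‖b j‖)) * A * (‖Y‖ * ‖Z‖) := by ring
        _ ≤ 17 * (N ^ 5 * N ^ 2) * D * (‖Y‖ * ‖Z‖) := by gcongr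
        _ = 17 * N ^ 7 * D * (‖Y‖ * ‖Z‖) := by ring
        _ ≤ 17 * N ^ 9 * D * (‖Y‖ * ‖Z‖) := by
            have h79 : N ^ 7 ≤ N ^ 9 := hN.pow_le_pow (by norm_num)
            gcongr
    have p4 : |(ginv G b x i j - ginv G' b x i j) * reactTerm G x (b i) (b j) Y Z|
        ≤ 16 * N ^ 9 * D * (‖Y‖ * ‖Z‖) := by
      rw [abs_mul]
      calc |ginv G b x i j - ginv G' b x i j| * |reactTerm G x (b i) (b j) Y Z|
          ≤ (N ^ 4 * H) * (16 * N ^ 3 * ‖b i‖ * ‖b j‖ * ‖Y‖ * ‖Z‖) :=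
            mul_le_mul g3 r4 (abs_nonneg _) (by positivity)
        _ = 16 * (N ^ 7 * (‖b i‖ * ‖b j‖)) * H * (‖Y‖ * ‖Z‖) := by ring
        _ ≤ 16 * (N ^ 7 * N ^ 2) * D * (‖Y‖ * ‖Z‖) := by gcongr
        _ = 16 * N ^ 9 * D * (‖Y‖ * ‖Z‖) := by ring
    have p5 : |ginv G' b x i j * reactPRem G G' x (b i) (b j) Y Z| ≤ 16 * N ^ 9 * D * (‖Y‖ * ‖Z‖) := by
      rw [abs_mul]
      calc |ginv G' b x i j| * |reactPRem G G' x (b i) (b j) Y Z|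
          ≤ N ^ 3 * (16 * N ^ 2 * (P + A) * ‖b i‖ * ‖b j‖ * ‖Y‖ * ‖Z‖) :=
            mul_le_mul g2 r5 (abs_nonneg _) (by positivity)
        _ = 16 * (N ^ 5 * (‖b i‖ * ‖b j‖)) * (P + A) * (‖Y‖ * ‖Z‖) := by ring
        _ ≤ 16 * (N ^ 5 * N ^ 2) * D * (‖Y‖ * ‖Z‖) := by gcongr
        _ = 16 * N ^ 7 * D * (‖Y‖ * ‖Z‖) := by ring
        _ ≤ 16 * N ^ 9 * D * (‖Y‖ * ‖Z‖) := by
            have h79 : N ^ 7 ≤ N ^ 9 := hN.pow_le_pow (by norm_num)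
            gcongr
    have s2 := (abs_add_le _ _).trans (add_le_add p1 p2)
    have s3 := (abs_add_le _ _).trans (add_le_add s2 p3)
    have s4 := (abs_add_le _ _).trans (add_le_add s3 p4)
    have s5 := (abs_add_le _ _).trans (add_le_add s4 p5)
    linarith
  calc |fRaw b G G' x Y Z|
      ≤ ∑ i, |∑ j, (ginv G b x i j * lapPRem G G' x (b i) (b j) Y Z
          + (ginv G b x i j - ginv G' b x i j) * cov₃At G (cov₂At G (ricAt G')) x (b i) (b j) Y Z
          + ginv G' b x i j * cov₃cov₂Rem G G' (ricAt G') x (b i) (b j) Y Z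
          + (ginv G b x i j - ginv G' b x i j) * reactTerm G x (b i) (b j) Y Z
          + ginv G' b x i j * reactPRem G G' x (b i) (b j) Y Z)| := Finset.abs_sum_le_sum_abs _ _
    _ ≤ ∑ i, ∑ j, |ginv G b x i j * lapPRem G G' x (b i) (b j) Y Z
          + (ginv G b x i j - ginv G' b x i j) * cov₃At G (cov₂At G (ricAt G')) x (b i) (b j) Y Z
          + ginv G' b x i j * cov₃cov₂Rem G G' (ricAt G') x (b i) (b j) Y Z
          + (ginv G b x i j - ginv G' b x i j) * reactTerm G x (b i) (b j) Y Z
          + ginv G' b x i j * reactPRem G G' x (b i) (b j) Y Z| :=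
        Finset.sum_le_sum fun i _ ↦ Finset.abs_sum_le_sum_abs _ _
    _ ≤ ∑ i : ι, ∑ j : ι, 76 * N ^ 9 * D * (‖Y‖ * ‖Z‖) :=
        Finset.sum_le_sum fun i _ ↦ Finset.sum_le_sum fun j _ ↦ key i j
    _ = 76 * (Fintype.card ι : ℝ) ^ 2 * N ^ 9 * D * ‖Y‖ * ‖Z‖ := by
        simp only [Finset.sum_const, Finset.card_univ, nsmul_eq_mul]
        ring

end Assembly





end MetricCoord

end Literature.Geometry.Lorentzian

end
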